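import Mathlib
import HarnessLib

/-!
# Uniqueness of collars of the sphere `∂𝔻` in the closed ball (ambient, elementary form)

Trunk T-4MAN (`Literature/Topology/FourManifolds`). First of three files discharging, for two
closed discs, the tree's named fact `Literature.Topology.FourManifolds.nonempty_diffeomorph_of_isBoundaryGluing` (`Gluing.lean`:
uniqueness of the gluing `M ∪_φ N`, Hirsch (1976), Ch. 8, Thm. 1.9 / Thm. 2.1), on which Cerf's
`Γ₄ = 0` in twisted-sphere form (`Literature.Topology.FourManifolds.cerf_twistedSphere_four`, `CerfGammaFour.lean`) depends
through `Literature.Topology.FourManifolds.cerf_twistedSphere_four_of_pi0Diff` (`RadialExtension.lean`). Hirsch's proof of the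
smoothing theorem 8.1.9 rests on the *uniqueness of collars* (Ch. 8, Thm. 1.8 and the remark after
it: the germ of an isotopy of collars extends to a diffeotopy), itself proved there with the
isotopy extension theorem (flows of time-dependent vector fields), which Mathlib lacks. This file
proves the case needed for discs by an elementary, self-contained argument in a finite-dimensional
real inner product space `E`:

* `Literature.IsInnerCollar ε θ θinv`: an **inner collar of the unit sphere in ambient coordinates** —
  `θ : E → E` is `C^∞` on the closed shell `{1 - ε < ‖x‖ ≤ 1}` (`Literature.closedShell ε`; smooth up
  to the sphere in the sense of derivatives within the ball), fixes the unit sphere pointwise,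
  maps the shell into the closed ball and the open shell into the open ball, and has a `C^∞`
  left inverse `θinv` on the shell. (A collar `c : 𝕊ⁿ × [0, ε) ↪ 𝔻ⁿ⁺¹` of `∂𝔻ⁿ⁺¹` gives
  `θ = c ∘ (x ↦ (x/‖x‖, 1 - ‖x‖))`; the standard radial collar gives `θ = id`.)
* `Literature.Topology.FourManifolds.IsInnerCollar.exists_openPartialHomeomorph_extend` (**main theorem**): for an inner
  collar `θ` there are `δ ∈ (0, ε)` and an `OpenPartialHomeomorph` `Θ` of `E` with
  `Θ.source = Θ.target = ball 0 1`, `C^∞` in both directions on the open ball, with `Θ = θ` on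
  the open shell `{1 - δ ≤ ‖x‖ < 1}` and `Θ = id` on the ball of radius `1 - ε`.
* `Literature.Topology.FourManifolds.IsInnerCollar.exists_openPartialHomeomorph_conj`: hence any two inner collars `θ₁, θ₂`
  differ near the sphere by a diffeomorphism `G` of the open ball: `G (θ₁ x) = θ₂ x` for
  `1 - δ ≤ ‖x‖ < 1` — the uniqueness of collars of `∂𝔻` up to diffeomorphism of the interior,
  in the form used by the smoothing argument for gluings of two discs (Hirsch, Thm. 8.1.9).

Nothing in this file depends on manifolds: it is finite-dimensional calculus in `E`.

## The proof

Write `t = 1 - ‖x‖` for the depth. The diffeomorphism is the **splice**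
`Θ_L x = x + ρ_L(t) • (θ x - x)` (`Literature.Topology.FourManifolds.IsInnerCollar.splice`) of `θ` (near the sphere, where
`ρ_L = 1`) with the identity (inside, where `ρ_L = 0`) along the **log-slow cutoff**
`ρ_L(t) = smoothTransition (-1 - log t / L)` (`Literature.Topology.FourManifolds.logCutoff`), which descends from `1` to `0` as
`t` goes from `e^{-2L}` to `e^{-L}` and satisfies `|t ρ_L'(t)| ≤ C₀ / L`
(`Literature.Topology.FourManifolds.abs_mul_deriv_logCutoff_le`) and `|ρ_L(a) - ρ_L(b)| ≤ (C₀/L) |log a - log b|`. Then: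

1. At a point `x` of the sphere the within-derivative `Dθ_x` is the identity on `xᗮ`
   (`fderivWithin_apply_of_inner_eq_zero`, since `θ = id` on the sphere), is injective
   (`injective_fderivWithin`, from the left inverse) and has `⟪x, Dθ_x x⟫ > 0`
   (`inner_fderivWithin_self_pos`: `σ ↦ ⟪x, θ ((1 - σ) x)⟫` is maximal at `σ = 0`); hence every
   convex combination `(1 - λ) I + λ Dθ_x`, `λ ∈ [0, 1]`, is invertible
   (`injective_convexCombination`).
2. By compactness of the sphere this gives a **uniform lower bound** `c ‖x - y‖ ≤ ‖B_λ x - B_λ y‖`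
   for all blends `B_λ = id + λ (θ - id)`, `λ ∈ [0, 1]`, on a thin closed shell of width `ε₃`
   (`exists_lower_bound_blend`, mean value inequality near the accumulation point), and the mean
   value inequality along radial segments gives `‖θ x - x‖ ≤ C₁ t` (`exists_norm_sub_self_le`).
3. For `L` large (`Literature.Topology.FourManifolds.IsInnerCollar.SpliceHyp`), `DΘ_L = [(1 - ρ) I + ρ Dθ] + R` with
   `‖R‖ ≤ |ρ'(t)| ‖θ x - x‖ ≤ C₁ |t ρ'(t)| ≤ C₀ C₁ / L ≤ c / 2` (`hasFDerivAt_splice`), so `DΘ_L`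
   is uniformly injective on the open ball (`exists_hasFDerivAt_lower`); `Θ_L` is injective on
   the open ball (`injOn_splice`: if `Θ x = Θ y` then `c ‖x - y‖ ≤ C₁ |ρ(t_x) - ρ(t_y)| min(t_x, t_y)
   ≤ (C₀ C₁ / L) |t_x - t_y| ≤ (c/2) ‖x - y‖`); and `Θ_L` maps the open ball onto itself
   (`surjOn_splice`: the image is open by the inverse function theorem and closed in the ball
   because `‖Θ x - x‖ ≤ C₁ t → 0` at the sphere, and the ball is connected).
4. The inverse is `C^∞` by `OpenPartialHomeomorph.contDiffAt_symm`.

## References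

* M. W. Hirsch, *Differential Topology*, GTM 33, Springer (1976), Ch. 4 §6 (collars), Ch. 8
  Thm. 1.8 and the remark following it (uniqueness of collars), Thm. 1.9 (smoothing theorem).
* J. R. Munkres, *Elementary Differential Topology*, Ann. of Math. Studies 54 (1966), §6
  (uniqueness of collars, smoothing of the seam).
-/

open scoped Topology ContDiff
open Set Function Metric Filter Real
open scoped InnerProductSpace RealInnerProductSpace

noncomputable section

namespace Literature.Topology.FourManifolds

/-! ### A bound for the derivative of `Real.smoothTransition` -/

/-- The derivative of Mathlib's `Real.smoothTransition` is bounded: there is `C > 0` with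
`|smoothTransition' x| ≤ C` for all `x` (the derivative is continuous and vanishes off `[0, 1]`).
[folklore] -/
theorem exists_bound_deriv_smoothTransition :
    ∃ C : ℝ, 0 < C ∧ ∀ x : ℝ, ‖deriv smoothTransition x‖ ≤ C := by
  have hc : Continuous (deriv smoothTransition) :=
    (smoothTransition.contDiff (n := 1)).continuous_deriv le_rfl
  obtain ⟨C, hC⟩ := (isCompact_Icc (a := (0 : ℝ)) (b := 1)).exists_bound_of_continuousOn
    hc.continuousOn
  refine ⟨max C 1, lt_max_of_lt_right one_pos, fun x => ?_⟩
  by_cases hx : x ∈ Icc (0 : ℝ) 1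
  · exact (hC x hx).trans (le_max_left _ _)
  · -- off `[0, 1]` the function is locally constant, so the derivative vanishes
    have h0 : deriv smoothTransition x = 0 := by
      rcases not_and_or.1 hx with h | h
      · have h' : x < 0 := lt_of_not_ge h
        have : smoothTransition =ᶠ[𝓝 x] fun _ => (0 : ℝ) := by
          filter_upwards [Iio_mem_nhds h'] with y hy
          exact smoothTransition.zero_of_nonpos hy.le
        rw [this.deriv_eq]; simp
      · have h' : 1 < x := lt_of_not_ge h
        have : smoothTransition =ᶠ[𝓝 x] fun _ => (1 : ℝ) := by
          filter_upwards [Ioi_mem_nhds h'] with y hy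
          exact smoothTransition.one_of_one_le hy.le
        rw [this.deriv_eq]; simp
    rw [h0, norm_zero]
    exact le_trans zero_le_one (le_max_right _ _)

/-- A fixed bound `C₀ > 0` for `|smoothTransition'|`. [folklore] -/
def smoothTransitionDerivBound : ℝ := Classical.choose exists_bound_deriv_smoothTransition

/-- The bound `C₀` is positive. [folklore] -/
theorem smoothTransitionDerivBound_pos : 0 < smoothTransitionDerivBound :=
  (Classical.choose_spec exists_bound_deriv_smoothTransition).1

/-- `|smoothTransition' x| ≤ C₀`. [folklore] -/
theorem norm_deriv_smoothTransition_le (x : ℝ) :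
    ‖deriv smoothTransition x‖ ≤ smoothTransitionDerivBound :=
  (Classical.choose_spec exists_bound_deriv_smoothTransition).2 x

/-! ### The log-slow cutoff -/

/-- The **log-slow cutoff** with parameter `L > 0`: `logCutoff L t = smoothTransition (-1 - log t / L)`.
For `t > 0` it equals `1` for `t ≤ e^{-2L}`, `0` for `t ≥ e^{-L}`, takes values in `[0, 1]`, and
satisfies `|t · (logCutoff L)' t| ≤ C₀ / L`: it varies on a logarithmic scale, so that its
derivative times the distance to `0` is uniformly small for large `L`. [folklore] -/
def logCutoff (L t : ℝ) : ℝ := smoothTransition (-1 - Real.log t / L)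

variable {L t : ℝ}

/-- The cutoff is nonnegative. [folklore] -/
theorem logCutoff_nonneg (L t : ℝ) : 0 ≤ logCutoff L t := smoothTransition.nonneg _

/-- The cutoff is at most `1`. [folklore] -/
theorem logCutoff_le_one (L t : ℝ) : logCutoff L t ≤ 1 := smoothTransition.le_one _

/-- The cutoff takes values in `[0, 1]`. [folklore] -/
theorem logCutoff_mem_Icc (L t : ℝ) : logCutoff L t ∈ Icc (0 : ℝ) 1 :=
  ⟨logCutoff_nonneg L t, logCutoff_le_one L t⟩

/-- `logCutoff L t = 1` for `0 < t ≤ e^{-2L}`. [folklore] -/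
theorem logCutoff_eq_one (hL : 0 < L) (ht : 0 < t) (htL : t ≤ exp (-2 * L)) : logCutoff L t = 1 := by
  unfold logCutoff
  apply smoothTransition.one_of_one_le
  have h1 : Real.log t ≤ -2 * L := by
    have := Real.log_le_log ht htL
    rwa [Real.log_exp] at this
  have h2 : Real.log t / L ≤ -2 := by
    rw [div_le_iff₀ hL]
    linarith
  linarith

/-- `logCutoff L t = 0` for `t ≥ e^{-L}`. [folklore] -/
theorem logCutoff_eq_zero (hL : 0 < L) (htL : exp (-L) ≤ t) : logCutoff L t = 0 := by
  unfold logCutoff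
  apply smoothTransition.zero_of_nonpos
  have ht : 0 < t := (exp_pos _).trans_le htL
  have h1 : -L ≤ Real.log t := by
    have := Real.log_le_log (exp_pos _) htL
    rwa [Real.log_exp] at this
  have h2 : -L / L ≤ Real.log t / L := div_le_div_of_nonneg_right h1 hL.le
  rw [neg_div, div_self hL.ne'] at h2
  linarith

/-- `logCutoff L` is smooth on `(0, ∞)`. [folklore] -/
theorem contDiffAt_logCutoff (ht : t ≠ 0) : ContDiffAt ℝ ∞ (logCutoff L) t := by
  unfold logCutoff
  have h1 : ContDiffAt ℝ ∞ (fun t => -1 - Real.log t / L) t :=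
    contDiffAt_const.sub ((Real.contDiffAt_log.2 ht).div_const L)
  exact smoothTransition.contDiffAt.comp t h1

/-- The derivative of the log-slow cutoff at `t ≠ 0`. [folklore] -/
theorem hasDerivAt_logCutoff (ht : t ≠ 0) :
    HasDerivAt (logCutoff L)
      (deriv smoothTransition (-1 - Real.log t / L) * (-(t⁻¹ / L))) t := by
  unfold logCutoff
  have h1 : HasDerivAt (fun t => -1 - Real.log t / L) (-(t⁻¹ / L)) t := by
    have := ((Real.hasDerivAt_log ht).div_const L).const_sub (-1)
    simpa using this
  have h2 : HasDerivAt smoothTransition (deriv smoothTransition (-1 - Real.log t / L))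
      (-1 - Real.log t / L) :=
    (smoothTransition.contDiffAt (n := 1)).differentiableAt one_ne_zero |>.hasDerivAt
  exact h2.comp t h1

/-- **Key estimate**: `|t · (logCutoff L)' t| ≤ C₀ / L` for `t ≠ 0`, `L > 0`. [folklore] -/
theorem abs_mul_deriv_logCutoff_le (hL : 0 < L) (ht : t ≠ 0) :
    |t * deriv (logCutoff L) t| ≤ smoothTransitionDerivBound / L := by
  rw [(hasDerivAt_logCutoff ht).deriv]
  have : t * (deriv smoothTransition (-1 - Real.log t / L) * -(t⁻¹ / L)) =
      -(deriv smoothTransition (-1 - Real.log t / L)) / L := by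
    field_simp
  rw [this, abs_div, abs_neg, abs_of_pos hL]
  exact div_le_div_of_nonneg_right (by simpa using norm_deriv_smoothTransition_le _) hL.le

/-- The log-slow cutoff is `C₀/L`-Lipschitz **in `log t`**: for `a, b > 0`,
`|logCutoff L a - logCutoff L b| ≤ (C₀ / L) * |log a - log b|`. [folklore] -/
theorem abs_logCutoff_sub_logCutoff_le (hL : 0 < L) {a b : ℝ} :
    |logCutoff L a - logCutoff L b| ≤
      smoothTransitionDerivBound / L * |Real.log a - Real.log b| := by
  -- `logCutoff L = g ∘ log` with `g u = smoothTransition (-1 - u / L)`, `|g'| ≤ C₀ / L`.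
  set g : ℝ → ℝ := fun u => smoothTransition (-1 - u / L) with hg
  have hg' : ∀ u, HasDerivAt g (deriv smoothTransition (-1 - u / L) * (-(1 / L))) u := by
    intro u
    have h1 : HasDerivAt (fun u => -1 - u / L) (-(1 / L)) u := by
      have := ((hasDerivAt_id u).div_const L).const_sub (-1)
      simpa using this
    have h2 : HasDerivAt smoothTransition (deriv smoothTransition (-1 - u / L)) (-1 - u / L) :=
      (smoothTransition.contDiffAt (n := 1)).differentiableAt one_ne_zero |>.hasDerivAt
    exact h2.comp u h1
  have hbound : ∀ u ∈ (univ : Set ℝ), ‖deriv g u‖ ≤ smoothTransitionDerivBound / L := by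
    intro u _
    rw [(hg' u).deriv, norm_mul, norm_neg, norm_div, norm_one, Real.norm_of_nonneg hL.le]
    calc ‖deriv smoothTransition (-1 - u / L)‖ * (1 / L)
        ≤ smoothTransitionDerivBound * (1 / L) :=
          mul_le_mul_of_nonneg_right (norm_deriv_smoothTransition_le _) (by positivity)
      _ = smoothTransitionDerivBound / L := by ring
  have := convex_univ.norm_image_sub_le_of_norm_deriv_le
    (fun u _ => (hg' u).differentiableAt) hbound (mem_univ (Real.log b)) (mem_univ (Real.log a))
  simpa only [hg, logCutoff, Real.norm_eq_abs] using this

/-- Elementary: `|log a - log b| ≤ |a - b| / min a b` for `a, b > 0`. [folklore] -/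
theorem abs_log_sub_log_le' {a b : ℝ} (ha : 0 < a) (hb : 0 < b) :
    |Real.log a - Real.log b| ≤ |a - b| / min a b := by
  -- by symmetry assume `b ≤ a`
  wlog hab : b ≤ a generalizing a b
  · have := this hb ha (le_of_not_ge hab)
    rwa [abs_sub_comm, abs_sub_comm b a, min_comm] at this
  rw [min_eq_right hab, abs_of_nonneg (sub_nonneg.2 (Real.log_le_log hb hab)),
    abs_of_nonneg (sub_nonneg.2 hab)]
  have h := Real.log_le_sub_one_of_pos (div_pos ha hb)
  rw [Real.log_div ha.ne' hb.ne'] at h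
  calc Real.log a - Real.log b ≤ a / b - 1 := h
    _ = (a - b) / b := by field_simp


/-! ### Shells -/

section Shell

variable {E : Type*} [NormedAddCommGroup E]

/-- The **closed shell** `{x | 1 - ε < ‖x‖ ≤ 1}`: a one-sided neighbourhood of the unit sphere in
the closed unit ball. [folklore] -/
def closedShell (ε : ℝ) : Set E := closedBall (0 : E) 1 ∩ {x | 1 - ε < ‖x‖}

/-- The **open shell** `{x | 1 - ε < ‖x‖ < 1}`. [folklore] -/
def openShell (ε : ℝ) : Set E := ball (0 : E) 1 ∩ {x | 1 - ε < ‖x‖}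

variable {ε ε' : ℝ} {x : E}

/-- Membership in the closed shell. [folklore] -/
theorem mem_closedShell_iff : x ∈ (closedShell ε : Set E) ↔ 1 - ε < ‖x‖ ∧ ‖x‖ ≤ 1 := by
  simp only [closedShell, mem_inter_iff, mem_closedBall, dist_zero_right, mem_setOf_eq, and_comm]

/-- Membership in the open shell. [folklore] -/
theorem mem_openShell_iff : x ∈ (openShell ε : Set E) ↔ 1 - ε < ‖x‖ ∧ ‖x‖ < 1 := by
  simp only [openShell, mem_inter_iff, mem_ball, dist_zero_right, mem_setOf_eq, and_comm]

/-- The exterior region `{1 - ε < ‖x‖}` is open. [folklore] -/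
theorem isOpen_lt_norm (ε : ℝ) : IsOpen {x : E | 1 - ε < ‖x‖} :=
  isOpen_lt continuous_const continuous_norm

/-- The open shell is open. [folklore] -/
theorem isOpen_openShell (ε : ℝ) : IsOpen (openShell ε : Set E) :=
  isOpen_ball.inter (isOpen_lt_norm ε)

/-- The open shell lies in the closed shell. [folklore] -/
theorem openShell_subset_closedShell : (openShell ε : Set E) ⊆ closedShell ε := fun _ hx =>
  mem_closedShell_iff.2 ⟨(mem_openShell_iff.1 hx).1, (mem_openShell_iff.1 hx).2.le⟩

/-- Closed shells are monotone in the width. [folklore] -/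
theorem closedShell_mono (h : ε' ≤ ε) : (closedShell ε' : Set E) ⊆ closedShell ε := fun _ hx =>
  mem_closedShell_iff.2 ⟨by linarith [(mem_closedShell_iff.1 hx).1], (mem_closedShell_iff.1 hx).2⟩

/-- Open shells are monotone in the width. [folklore] -/
theorem openShell_mono (h : ε' ≤ ε) : (openShell ε' : Set E) ⊆ openShell ε := fun _ hx =>
  mem_openShell_iff.2 ⟨by linarith [(mem_openShell_iff.1 hx).1], (mem_openShell_iff.1 hx).2⟩

/-- The closed shell lies in the closed unit ball. [folklore] -/
theorem closedShell_subset_closedBall : (closedShell ε : Set E) ⊆ closedBall 0 1 :=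
  inter_subset_left

/-- The open shell lies in the open unit ball. [folklore] -/
theorem openShell_subset_ball : (openShell ε : Set E) ⊆ ball 0 1 := inter_subset_left

/-- The unit sphere lies in every closed shell of positive width. [folklore] -/
theorem mem_closedShell_of_norm_eq_one (hε : 0 < ε) (hx : ‖x‖ = 1) : x ∈ (closedShell ε : Set E) :=
  mem_closedShell_iff.2 ⟨by linarith, hx.le⟩

/-- A point of the closed shell off the sphere lies in the open shell. [folklore] -/
theorem mem_openShell_of_mem_closedShell_of_norm_lt (hx : x ∈ (closedShell ε : Set E))
    (h1 : ‖x‖ < 1) : x ∈ (openShell ε : Set E) :=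
  mem_openShell_iff.2 ⟨(mem_closedShell_iff.1 hx).1, h1⟩

/-- Near a point of the closed shell, the closed shell agrees with the closed ball. [folklore] -/
theorem closedShell_mem_nhdsWithin (hx : x ∈ (closedShell ε : Set E)) :
    (closedShell ε : Set E) ∈ 𝓝[closedBall (0 : E) 1] x :=
  inter_mem_nhdsWithin _ ((isOpen_lt_norm ε).mem_nhds (mem_closedShell_iff.1 hx).1)

/-- The open shell is a neighbourhood of each of its points. [folklore] -/
theorem openShell_mem_nhds (hx : x ∈ (openShell ε : Set E)) : (openShell ε : Set E) ∈ 𝓝 x :=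
  (isOpen_openShell ε).mem_nhds hx

variable [NormedSpace ℝ E]

/-- The closed shell has the unique differentiability property (it is locally the closed ball,
a convex set with nonempty interior). [folklore] -/
theorem uniqueDiffOn_closedShell (ε : ℝ) : UniqueDiffOn ℝ (closedShell ε : Set E) := by
  intro x hx
  have h1 : UniqueDiffOn ℝ (closedBall (0 : E) 1) :=
    uniqueDiffOn_convex (convex_closedBall 0 1)
      ⟨0, by rw [interior_closedBall _ one_ne_zero]; exact mem_ball_self one_pos⟩
  exact (h1 x hx.1).inter ((isOpen_lt_norm ε).mem_nhds hx.2)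

/-- A radial rescaling `t • x` with `1 - ε < t‖x‖ ≤ 1`... specialised: for `‖x‖ = 1` and
`0 ≤ σ < ε`, the point `(1 - σ) • x` lies in the closed shell. [folklore] -/
theorem smul_mem_closedShell_of_norm_eq_one (hx : ‖x‖ = 1) {σ : ℝ} (h0 : 0 ≤ σ) (hσ : σ < ε)
    (hσ1 : σ ≤ 1) : (1 - σ) • x ∈ (closedShell ε : Set E) := by
  rw [mem_closedShell_iff, norm_smul, hx, mul_one, Real.norm_of_nonneg (by linarith)]
  constructor <;> linarith

end Shell

/-! ### Inner collars of the sphere in the ball -/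

section InnerCollar

variable {E : Type*} [NormedAddCommGroup E] [InnerProductSpace ℝ E]

/-- **An inner collar of the unit sphere, in ambient coordinates.** `θ` is a `C^∞` map on the
closed shell `{1 - ε < ‖x‖ ≤ 1}` (smooth up to the sphere in the sense of derivatives within the
ball) which fixes the unit sphere pointwise, maps the shell into the closed unit ball and the open
shell into the open unit ball, and admits a `C^∞` left inverse `θinv` on the shell. This is how
a collar `𝕊 × [0, ε) ↪ 𝔻` of `∂𝔻 = 𝕊` presents itself after composing with polar coordinates
`(z, t) ↦ (1 - t) z`; the standard collar is `θ = id`. Hirsch (1976), §4.6 (collars).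
[cite: HirschDT1976, §4.6] -/
structure IsInnerCollar (ε : ℝ) (θ θinv : E → E) : Prop where
  pos : 0 < ε
  contDiffOn : ContDiffOn ℝ ∞ θ (closedShell ε)
  contDiffOn_symm : ContDiffOn ℝ ∞ θinv (closedShell ε)
  eq_self : ∀ x : E, ‖x‖ = 1 → θ x = x
  norm_le_one : ∀ x ∈ (closedShell ε : Set E), ‖θ x‖ ≤ 1
  norm_lt_one : ∀ x ∈ (closedShell ε : Set E), ‖x‖ < 1 → ‖θ x‖ < 1
  left_inv : ∀ x ∈ (closedShell ε : Set E), θ x ∈ (closedShell ε : Set E) → θinv (θ x) = x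

namespace IsInnerCollar

variable {ε ε' : ℝ} {θ θinv : E → E}

/-- The identity is an inner collar (the standard collar of `∂𝔻`). [folklore] -/
theorem id (hε : 0 < ε) : IsInnerCollar ε (_root_.id : E → E) _root_.id where
  pos := hε
  contDiffOn := contDiff_id.contDiffOn
  contDiffOn_symm := contDiff_id.contDiffOn
  eq_self _ _ := rfl
  norm_le_one _ hx := (mem_closedShell_iff.1 hx).2
  norm_lt_one _ _ h := h
  left_inv _ _ _ := rfl

/-- Shrinking the shell. [folklore] -/
theorem mono (h : IsInnerCollar ε θ θinv) (hε' : 0 < ε') (hle : ε' ≤ ε) :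
    IsInnerCollar ε' θ θinv where
  pos := hε'
  contDiffOn := h.contDiffOn.mono (closedShell_mono hle)
  contDiffOn_symm := h.contDiffOn_symm.mono (closedShell_mono hle)
  eq_self := h.eq_self
  norm_le_one x hx := h.norm_le_one x (closedShell_mono hle hx)
  norm_lt_one x hx := h.norm_lt_one x (closedShell_mono hle hx)
  left_inv x hx hx' := h.left_inv x (closedShell_mono hle hx) (closedShell_mono hle hx')

/-- An inner collar maps the closed shell into the closed unit ball. [folklore] -/
theorem mapsTo (h : IsInnerCollar ε θ θinv) : MapsTo θ (closedShell ε) (closedBall (0 : E) 1) :=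
  fun x hx => mem_closedBall_zero_iff.2 (h.norm_le_one x hx)

/-- An inner collar maps the open shell into the open unit ball. [folklore] -/
theorem mapsTo_ball (h : IsInnerCollar ε θ θinv) : MapsTo θ (openShell ε) (ball (0 : E) 1) :=
  fun x hx => mem_ball_zero_iff.2
    (h.norm_lt_one x (openShell_subset_closedShell hx) (mem_openShell_iff.1 hx).2)

/-- The unit sphere lies in every closed shell of positive width. [folklore] -/
theorem mem_closedShell_of_norm_eq_one (h : IsInnerCollar ε θ θinv) {x : E} (hx : ‖x‖ = 1) :
    x ∈ (closedShell ε : Set E) :=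
  Literature.Topology.FourManifolds.mem_closedShell_of_norm_eq_one h.pos hx

/-- The derivative of the collar within the shell. [folklore] -/
theorem hasFDerivWithinAt (h : IsInnerCollar ε θ θinv) {x : E} (hx : x ∈ (closedShell ε : Set E)) :
    HasFDerivWithinAt θ (fderivWithin ℝ θ (closedShell ε) x) (closedShell ε) x :=
  ((h.contDiffOn.differentiableOn (by simp)) x hx).hasFDerivWithinAt

/-- The derivative of the left inverse within the shell. [folklore] -/
theorem hasFDerivWithinAt_symm (h : IsInnerCollar ε θ θinv) {x : E}
    (hx : x ∈ (closedShell ε : Set E)) :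
    HasFDerivWithinAt θinv (fderivWithin ℝ θinv (closedShell ε) x) (closedShell ε) x :=
  ((h.contDiffOn_symm.differentiableOn (by simp)) x hx).hasFDerivWithinAt

/-- The derivative of the collar is continuous on the shell. [folklore] -/
theorem continuousOn_fderivWithin (h : IsInnerCollar ε θ θinv) :
    ContinuousOn (fun x => fderivWithin ℝ θ (closedShell ε) x) (closedShell ε) :=
  h.contDiffOn.continuousOn_fderivWithin (uniqueDiffOn_closedShell ε) (by simp)

/-- At interior points of the shell the within-derivative is the derivative. [folklore] -/
theorem hasFDerivAt (h : IsInnerCollar ε θ θinv) {x : E} (hx : x ∈ (openShell ε : Set E)) :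
    HasFDerivAt θ (fderivWithin ℝ θ (closedShell ε) x) x :=
  (h.hasFDerivWithinAt (openShell_subset_closedShell hx)).hasFDerivAt
    (mem_of_superset (openShell_mem_nhds hx) openShell_subset_closedShell)

/-- An inner collar is `C^∞` at points of the open shell. [folklore] -/
theorem contDiffAt (h : IsInnerCollar ε θ θinv) {x : E} (hx : x ∈ (openShell ε : Set E)) :
    ContDiffAt ℝ ∞ θ x :=
  h.contDiffOn.contDiffAt (mem_of_superset (openShell_mem_nhds hx) openShell_subset_closedShell)

/-- An inner collar is continuous within the shell. [folklore] -/
theorem continuousWithinAt (h : IsInnerCollar ε θ θinv) {x : E}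
    (hx : x ∈ (closedShell ε : Set E)) : ContinuousWithinAt θ (closedShell ε) x :=
  (h.contDiffOn x hx).continuousWithinAt

/-! #### The derivative at points of the sphere -/

/-- **Tangentially, the derivative of a collar at a point of the sphere is the identity**: the
collar fixes the sphere pointwise, so its derivative fixes tangent vectors `v ⊥ x`. [folklore] -/
theorem fderivWithin_apply_of_inner_eq_zero (h : IsInnerCollar ε θ θinv) {x : E} (hx : ‖x‖ = 1)
    {v : E} (hv : ⟪x, v⟫_ℝ = 0) : fderivWithin ℝ θ (closedShell ε) x v = v := by
  set L := fderivWithin ℝ θ (closedShell ε) x with hL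
  -- first for unit vectors `u ⊥ x`, along the great circle `σ ↦ cos σ • x + sin σ • u`
  have key : ∀ u : E, ‖u‖ = 1 → ⟪x, u⟫_ℝ = 0 → L u = u := by
    intro u hu hxu
    set γ : ℝ → E := fun σ => Real.cos σ • x + Real.sin σ • u with hγ
    have hnorm : ∀ σ, ‖γ σ‖ = 1 := by
      intro σ
      have h2 : ‖γ σ‖ ^ 2 = 1 := by
        rw [hγ]
        dsimp only
        rw [norm_add_sq_real, norm_smul, norm_smul, hx, hu, mul_one, mul_one,
          real_inner_smul_left, real_inner_smul_right, hxu, mul_zero, mul_zero, mul_zero,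
          add_zero, Real.norm_eq_abs, Real.norm_eq_abs, sq_abs, sq_abs, Real.cos_sq_add_sin_sq]
      have h3 : 0 ≤ ‖γ σ‖ := norm_nonneg _
      nlinarith [h2, h3]
    have hγd : HasDerivAt γ u 0 := by
      have := ((Real.hasDerivAt_cos 0).smul_const x).add ((Real.hasDerivAt_sin 0).smul_const u)
      simpa [hγ, Pi.add_def] using this
    have hγ0 : γ 0 = x := by simp [hγ]
    have hθx : HasFDerivWithinAt θ L (closedShell ε) (γ 0) := by
      rw [hγ0]; exact h.hasFDerivWithinAt (h.mem_closedShell_of_norm_eq_one hx)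
    have hcomp : HasDerivWithinAt (θ ∘ γ) (L u) univ 0 :=
      hθx.comp_hasDerivWithinAt (0 : ℝ) hγd.hasDerivWithinAt
        (fun σ _ => h.mem_closedShell_of_norm_eq_one (hnorm σ))
    have heq : θ ∘ γ = γ := funext fun σ => h.eq_self _ (hnorm σ)
    rw [heq, hasDerivWithinAt_univ] at hcomp
    exact hcomp.unique hγd
  by_cases hv0 : v = 0
  · rw [hv0, map_zero]
  · have hvn : ‖v‖ ≠ 0 := norm_ne_zero_iff.2 hv0
    have hu : ‖‖v‖⁻¹ • v‖ = 1 := by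
      rw [norm_smul, norm_inv, norm_norm, inv_mul_cancel₀ hvn]
    have hxu : ⟪x, ‖v‖⁻¹ • v⟫_ℝ = 0 := by rw [real_inner_smul_right, hv, mul_zero]
    have := key _ hu hxu
    rw [map_smul] at this
    have h2 := congrArg (fun w => ‖v‖ • w) this
    simp only [smul_smul, mul_inv_cancel₀ hvn, one_smul] at h2
    exact h2

/-- **The derivative of a collar at a point of the sphere is injective** (the collar has a smooth
left inverse on the shell). [folklore] -/
theorem injective_fderivWithin (h : IsInnerCollar ε θ θinv) {x : E} (hx : ‖x‖ = 1) :
    Injective (fderivWithin ℝ θ (closedShell ε) x) := by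
  set s : Set E := closedShell ε with hs
  set L := fderivWithin ℝ θ s x with hL
  set L' := fderivWithin ℝ θinv s x with hL'
  have hxs : x ∈ s := h.mem_closedShell_of_norm_eq_one hx
  have hθx : θ x = x := h.eq_self x hx
  -- near `x` within the shell, `θ` stays in the shell, so `θinv ∘ θ = id` there
  set t : Set E := θ ⁻¹' s with ht
  have htmem : t ∈ 𝓝[s] x := by
    have hU : {y : E | 1 - ε < ‖y‖} ∈ 𝓝 (θ x) := by
      rw [hθx]; exact (isOpen_lt_norm ε).mem_nhds (by simp only [mem_setOf_eq, hx]; linarith [h.pos])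
    have h1 : ∀ᶠ y in 𝓝[s] x, θ y ∈ {y : E | 1 - ε < ‖y‖} := h.continuousWithinAt hxs hU
    have h2 : ∀ᶠ y in 𝓝[s] x, y ∈ s := self_mem_nhdsWithin
    filter_upwards [h1, h2] with y hy1 hy2
    exact ⟨mem_closedBall_zero_iff.2 (h.norm_le_one y hy2), hy1⟩
  have hst : MapsTo θ (s ∩ t) s := fun y hy => hy.2
  have hθ' : HasFDerivWithinAt θ L (s ∩ t) x := (h.hasFDerivWithinAt hxs).mono inter_subset_left
  have hθinv : HasFDerivWithinAt θinv L' s (θ x) := by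
    rw [hθx]; exact h.hasFDerivWithinAt_symm hxs
  have hcomp : HasFDerivWithinAt (θinv ∘ θ) (L'.comp L) (s ∩ t) x := hθinv.comp x hθ' hst
  have hid : HasFDerivWithinAt (fun y : E => y) (L'.comp L) (s ∩ t) x :=
    hcomp.congr (fun y hy => (h.left_inv y hy.1 hy.2).symm) (h.left_inv x hxs (by rwa [hθx])).symm
  have huniq : UniqueDiffWithinAt ℝ (s ∩ t) x :=
    (uniqueDiffOn_closedShell ε x hxs).inter' htmem
  have heq : L'.comp L = ContinuousLinearMap.id ℝ E := huniq.eq hid (hasFDerivWithinAt_id x _)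
  intro v w hvw
  have := congrArg L' hvw
  have hv : L' (L v) = v := by simpa using congrArg (fun T : E →L[ℝ] E => T v) heq
  have hw : L' (L w) = w := by simpa using congrArg (fun T : E →L[ℝ] E => T w) heq
  rw [hv, hw] at this
  exact this

variable [FiniteDimensional ℝ E]

/-- **The derivative of a collar at a point `x` of the sphere moves `x` off the tangent
hyperplane, to the side of the ball**: `0 < ⟪x, Dθ_x x⟫`. Nonnegativity because `θ` maps the
shell into the ball (`σ ↦ ⟪x, θ ((1 - σ) x)⟫` is maximal at `σ = 0`), non-vanishing because
`Dθ_x` is invertible and is the identity on `xᗮ`. [folklore] -/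
theorem inner_fderivWithin_self_pos (h : IsInnerCollar ε θ θinv) {x : E} (hx : ‖x‖ = 1) :
    0 < ⟪x, fderivWithin ℝ θ (closedShell ε) x x⟫_ℝ := by
  set s : Set E := closedShell ε with hs
  set L := fderivWithin ℝ θ s x with hL
  have hxs : x ∈ s := h.mem_closedShell_of_norm_eq_one hx
  have hθx : θ x = x := h.eq_self x hx
  have hxx : ⟪x, x⟫_ℝ = 1 := by rw [real_inner_self_eq_norm_sq, hx, one_pow]
  -- (1) nonnegativity via the one-sided maximum of `σ ↦ ⟪x, θ ((1 - σ) • x)⟫` at `σ = 0`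
  have hnonneg : 0 ≤ ⟪x, L x⟫_ℝ := by
    set p : ℝ → E := fun σ => (1 - σ) • x with hp
    have hp0 : p 0 = x := by simp [hp]
    have hpd : HasDerivAt p (-x) 0 := by
      have := ((hasDerivAt_id (0 : ℝ)).const_sub 1).smul_const x
      simpa [hp] using this
    set ε₁ : ℝ := min ε 1 with hε₁
    have hε₁pos : 0 < ε₁ := lt_min h.pos one_pos
    have hmaps : MapsTo p (Ico 0 ε₁) s := fun σ hσ =>
      smul_mem_closedShell_of_norm_eq_one hx hσ.1 (hσ.2.trans_le (min_le_left _ _))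
        (hσ.2.le.trans (min_le_right _ _))
    have hθp : HasFDerivWithinAt θ L s (p 0) := by rw [hp0]; exact h.hasFDerivWithinAt hxs
    have hcomp : HasDerivWithinAt (θ ∘ p) (L (-x)) (Ico 0 ε₁) 0 :=
      hθp.comp_hasDerivWithinAt (0 : ℝ) hpd.hasDerivWithinAt hmaps
    have hg : HasDerivWithinAt (fun σ => ⟪x, (θ ∘ p) σ⟫_ℝ) (⟪x, L (-x)⟫_ℝ) (Ico 0 ε₁) 0 := by
      have := (hasDerivWithinAt_const (0 : ℝ) (Ico 0 ε₁) x).inner ℝ hcomp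
      simpa only [inner_zero_left, add_zero] using this
    have hmax : IsLocalMaxOn (fun σ => ⟪x, (θ ∘ p) σ⟫_ℝ) (Ico 0 ε₁) 0 := by
      refine eventually_nhdsWithin_of_forall fun σ hσ => ?_
      have h0 : ⟪x, (θ ∘ p) 0⟫_ℝ = 1 := by
        simp only [comp_apply, hp0, hθx, hxx]
      dsimp only
      rw [h0]
      calc ⟪x, (θ ∘ p) σ⟫_ℝ ≤ ‖x‖ * ‖(θ ∘ p) σ‖ := real_inner_le_norm _ _
        _ ≤ 1 * 1 := by
          gcongr
          · exact hx.le
          · exact h.norm_le_one _ (hmaps hσ)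
        _ = 1 := one_mul 1
    have hcone : (ε₁ / 2 : ℝ) ∈ posTangentConeAt (Ico (0 : ℝ) ε₁) 0 := by
      apply mem_posTangentConeAt_of_segment_subset
      rw [zero_add, segment_eq_Icc (by linarith)]
      exact Icc_subset_Ico_right (by linarith)
    have := hmax.hasFDerivWithinAt_nonpos hg.hasFDerivWithinAt hcone
    simp only [ContinuousLinearMap.toSpanSingleton_apply, smul_eq_mul, map_neg, inner_neg_right]
      at this
    by_contra hneg
    rw [not_le] at hneg
    have : (ε₁ / 2) * ⟪x, L x⟫_ℝ < 0 := mul_neg_of_pos_of_neg (by linarith) hneg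
    linarith
  -- (2) non-vanishing via surjectivity of `L` and `L = id` on `xᗮ`
  have hne : ⟪x, L x⟫_ℝ ≠ 0 := by
    intro h0
    have hall : ∀ w : E, ⟪x, L w⟫_ℝ = 0 := by
      intro w
      set v := w - ⟪x, w⟫_ℝ • x with hv
      have hxv : ⟪x, v⟫_ℝ = 0 := by
        rw [hv, inner_sub_right, real_inner_smul_right, hxx, mul_one, sub_self]
      have hLv : L v = v := h.fderivWithin_apply_of_inner_eq_zero hx hxv
      have hw : w = v + ⟪x, w⟫_ℝ • x := by rw [hv]; abel
      rw [hw, map_add, map_smul, hLv, inner_add_right, hxv, real_inner_smul_right, h0, mul_zero,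
        add_zero]
    have hsurj : Surjective L := by
      have := LinearMap.injective_iff_surjective.1
        (show Injective (L : E →ₗ[ℝ] E) from h.injective_fderivWithin hx)
      exact this
    obtain ⟨w, hw⟩ := hsurj x
    have := hall w
    rw [hw, hxx] at this
    exact one_ne_zero this
  exact lt_of_le_of_ne hnonneg (Ne.symm hne)

/-- **Convex combinations `(1 - λ) I + λ Dθ_x` are injective** at points `x` of the sphere, for
`λ ∈ [0, 1]`: they are the identity on `xᗮ` and send `x` to a vector with positive
`x`-component. [folklore] -/
theorem injective_convexCombination (h : IsInnerCollar ε θ θinv) {x : E} (hx : ‖x‖ = 1) {t : ℝ}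
    (ht : t ∈ Icc (0 : ℝ) 1) :
    Injective ((1 - t) • ContinuousLinearMap.id ℝ E + t • fderivWithin ℝ θ (closedShell ε) x) := by
  set L := fderivWithin ℝ θ (closedShell ε) x with hL
  set M := (1 - t) • ContinuousLinearMap.id ℝ E + t • L with hM
  have hxx : ⟪x, x⟫_ℝ = 1 := by rw [real_inner_self_eq_norm_sq, hx, one_pow]
  have hc := h.inner_fderivWithin_self_pos hx
  have hk : 0 < (1 - t) + t * ⟪x, L x⟫_ℝ := by
    rcases ht.1.eq_or_lt with rfl | hpos
    · simp
    · nlinarith [mul_pos hpos hc, ht.2]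
  -- injectivity of a linear map from triviality of its kernel
  refine (injective_iff_map_eq_zero M).2 fun w hw => ?_
  have hw' : M w = 0 := hw
  set v := w - ⟪x, w⟫_ℝ • x with hv
  have hxv : ⟪x, v⟫_ℝ = 0 := by
    rw [hv, inner_sub_right, real_inner_smul_right, hxx, mul_one, sub_self]
  have hLv : L v = v := h.fderivWithin_apply_of_inner_eq_zero hx hxv
  have hwv : w = v + ⟪x, w⟫_ℝ • x := by rw [hv]; abel
  have hMw : M w = v + ⟪x, w⟫_ℝ • ((1 - t) • x + t • L x) := by
    have hMw0 : M w = (1 - t) • w + t • L w := rfl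
    rw [hMw0]
    conv_lhs => rw [hwv]
    rw [map_add, map_smul, hLv]
    module
  have hinner : ⟪x, M w⟫_ℝ = ⟪x, w⟫_ℝ * ((1 - t) + t * ⟪x, L x⟫_ℝ) := by
    rw [hMw, inner_add_right, hxv, real_inner_smul_right, inner_add_right, real_inner_smul_right,
      real_inner_smul_right, hxx]
    ring
  rw [hw', inner_zero_right] at hinner
  have hxw : ⟪x, w⟫_ℝ = 0 := by
    rcases mul_eq_zero.1 hinner.symm with h1 | h1
    · exact h1
    · exact absurd h1 hk.ne'
  have hwv' : w = v := by rw [hwv, hxw, zero_smul, add_zero]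
  have : M w = w := by
    rw [hMw, hxw, zero_smul, add_zero, hwv']
  rw [← this, hw']

/-! #### A radial Lipschitz bound: `‖θ x - x‖ ≤ C₁ (1 - ‖x‖)` -/

omit [FiniteDimensional ℝ E] in
/-- The radial segment from `x/‖x‖` to `x` stays at norms between `‖x‖` and `1`. [folklore] -/
theorem segment_subset_of_norm {x : E} (hx0 : x ≠ 0) (hx1 : ‖x‖ ≤ 1) {z : E}
    (hz : z ∈ segment ℝ (‖x‖⁻¹ • x) x) : ‖x‖ ≤ ‖z‖ ∧ ‖z‖ ≤ 1 := by
  rw [segment_eq_image'] at hz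
  obtain ⟨s, hs, rfl⟩ := hz
  have hnx : 0 < ‖x‖ := norm_pos_iff.2 hx0
  have hxhat : ‖‖x‖⁻¹ • x‖ = 1 := by
    rw [norm_smul, norm_inv, norm_norm, inv_mul_cancel₀ hnx.ne']
  -- the point is `((1 - s) ‖x‖⁻¹ + s) • x`, of norm `(1 - s) + s ‖x‖`
  have heq : ‖x‖⁻¹ • x + s • (x - ‖x‖⁻¹ • x) = ((1 - s) + s * ‖x‖) • (‖x‖⁻¹ • x) := by
    rw [smul_smul]
    match_scalars
    field_simp
    ring
  have hcoef : 0 ≤ (1 - s) + s * ‖x‖ := by nlinarith [hs.1, hs.2, hnx]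
  dsimp only
  rw [heq, norm_smul, hxhat, mul_one, Real.norm_of_nonneg hcoef]
  constructor <;> nlinarith [hs.1, hs.2, hnx, hx1]

/-- **Radial Lipschitz bound.** On a slightly smaller closed shell, `‖θ x - x‖ ≤ C₁ (1 - ‖x‖)`:
the collar moves points by at most a constant times their distance to the sphere (mean value
inequality along radial segments, `θ = id` on the sphere). [folklore] -/
theorem exists_norm_sub_self_le (h : IsInnerCollar ε θ θinv) {ε₃ : ℝ} (hlt : ε₃ < ε) :
    ∃ C₁ : ℝ, 0 < C₁ ∧ ∀ x ∈ (closedShell ε₃ : Set E), ‖θ x - x‖ ≤ C₁ * (1 - ‖x‖) := by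
  set s : Set E := closedShell ε with hs
  -- the compact shell `K₃ = {1 - ε₃ ≤ ‖x‖ ≤ 1} ⊆ s`
  set K₃ : Set E := closedBall (0 : E) 1 ∩ {x | 1 - ε₃ ≤ ‖x‖} with hK₃
  have hK₃c : IsCompact K₃ :=
    (isCompact_closedBall 0 1).inter_right (isClosed_le continuous_const continuous_norm)
  have hK₃s : K₃ ⊆ s := fun z hz =>
    mem_closedShell_iff.2 ⟨by linarith [hz.2.out], mem_closedBall_zero_iff.1 hz.1⟩
  obtain ⟨B, hB⟩ := hK₃c.exists_bound_of_continuousOn (h.continuousOn_fderivWithin.mono hK₃s)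
  refine ⟨max B 0 + 1, by positivity, fun x hx => ?_⟩
  have hx1 : ‖x‖ ≤ 1 := (mem_closedShell_iff.1 hx).2
  by_cases hx0 : x = 0
  · subst hx0
    have : ‖θ 0‖ ≤ 1 := h.norm_le_one 0 (closedShell_mono hlt.le hx)
    simp only [sub_zero, norm_zero]
    nlinarith [le_max_right B 0]
  have hnx : 0 < ‖x‖ := norm_pos_iff.2 hx0
  set xh : E := ‖x‖⁻¹ • x with hxh
  have hxh1 : ‖xh‖ = 1 := by
    rw [hxh, norm_smul, norm_inv, norm_norm, inv_mul_cancel₀ hnx.ne']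
  have hseg : segment ℝ xh x ⊆ K₃ := fun z hz => by
    obtain ⟨h1, h2⟩ := segment_subset_of_norm hx0 hx1 hz
    exact ⟨mem_closedBall_zero_iff.2 h2, by
      simp only [mem_setOf_eq]; linarith [(mem_closedShell_iff.1 hx).1]⟩
  -- mean value inequality for `θ - id` on the radial segment
  have hderiv : ∀ z ∈ segment ℝ xh x, HasFDerivWithinAt (fun y => θ y - y)
      (fderivWithin ℝ θ s z - ContinuousLinearMap.id ℝ E) (segment ℝ xh x) z := fun z hz =>
    ((h.hasFDerivWithinAt (hK₃s (hseg hz))).sub (hasFDerivWithinAt_id z s)).mono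
      ((hseg.trans hK₃s))
  have hbound : ∀ z ∈ segment ℝ xh x,
      ‖fderivWithin ℝ θ s z - ContinuousLinearMap.id ℝ E‖ ≤ max B 0 + 1 := fun z hz =>
    calc ‖fderivWithin ℝ θ s z - ContinuousLinearMap.id ℝ E‖
        ≤ ‖fderivWithin ℝ θ s z‖ + ‖ContinuousLinearMap.id ℝ E‖ := norm_sub_le _ _
      _ ≤ max B 0 + 1 :=
        add_le_add ((hB z (hseg hz)).trans (le_max_left _ _)) ContinuousLinearMap.norm_id_le
  have hmvt := (convex_segment xh x).norm_image_sub_le_of_norm_hasFDerivWithin_le hderiv hbound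
    (left_mem_segment ℝ xh x) (right_mem_segment ℝ xh x)
  have hθxh : θ xh = xh := h.eq_self xh hxh1
  have hdiff : x - xh = (‖x‖ - 1) • xh := by
    rw [hxh, smul_smul, sub_mul, mul_inv_cancel₀ hnx.ne', one_mul, sub_smul, one_smul]
  have hnd : ‖x - xh‖ = 1 - ‖x‖ := by
    rw [hdiff, norm_smul, hxh1, mul_one, Real.norm_eq_abs, abs_sub_comm, abs_of_nonneg (by linarith)]
  simpa only [hθxh, sub_self, sub_zero, hnd] using hmvt

/-! #### The blend maps `x ↦ x + t (θ x - x)` and a uniform lower bound -/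

omit [FiniteDimensional ℝ E] in
/-- Derivative of the blend `y ↦ y + t • (θ y - y)` within the shell: the convex combination
`(1 - t) I + t Dθ`. [folklore] -/
theorem hasFDerivWithinAt_blend (h : IsInnerCollar ε θ θinv) (t : ℝ) {z : E}
    (hz : z ∈ (closedShell ε : Set E)) :
    HasFDerivWithinAt (fun y => y + t • (θ y - y))
      ((1 - t) • ContinuousLinearMap.id ℝ E + t • fderivWithin ℝ θ (closedShell ε) z)
      (closedShell ε) z := by
  have := (hasFDerivWithinAt_id z (closedShell ε)).add
    (((h.hasFDerivWithinAt hz).sub (hasFDerivWithinAt_id z (closedShell ε))).const_smul t)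
  have heq : (1 - t) • ContinuousLinearMap.id ℝ E + t • fderivWithin ℝ θ (closedShell ε) z =
      ContinuousLinearMap.id ℝ E +
        t • (fderivWithin ℝ θ (closedShell ε) z - ContinuousLinearMap.id ℝ E) := by
    module
  rw [heq]
  exact this

/-- **Uniform lower bound for the blends near the sphere.** There are `ε₃ ∈ (0, ε)` and `c > 0`
such that every blend `B_t = id + t (θ - id)`, `t ∈ [0, 1]`, satisfies
`c ‖x - y‖ ≤ ‖B_t x - B_t y‖` on the closed shell of width `ε₃`. Proof by compactness: a failure
along a sequence accumulates at a sphere point `x₀` and a parameter `t₀`, where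
`(1 - t₀) I + t₀ Dθ_{x₀}` is invertible (`injective_convexCombination`), and the mean value
inequality near `x₀` gives a contradiction. [folklore] -/
theorem exists_lower_bound_blend (h : IsInnerCollar ε θ θinv) :
    ∃ ε₃ c : ℝ, 0 < ε₃ ∧ ε₃ < ε ∧ 0 < c ∧ ∀ t ∈ Icc (0 : ℝ) 1,
      ∀ x ∈ (closedShell ε₃ : Set E), ∀ y ∈ (closedShell ε₃ : Set E),
        c * ‖x - y‖ ≤ ‖(x + t • (θ x - x)) - (y + t • (θ y - y))‖ := by
  set s : Set E := closedShell ε with hs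
  set B : ℝ → E → E := fun t x => x + t • (θ x - x) with hB
  by_contra hcon
  simp only [not_exists, not_and, not_forall, not_le, exists_prop] at hcon
  -- a sequence of failures on shells of width `u k = ε / (k + 2) → 0`, with constant `u k`
  set u : ℕ → ℝ := fun k => ε / ((k : ℝ) + 2) with hu
  have hupos : ∀ k, 0 < u k := fun k => div_pos h.pos (by positivity)
  have hult : ∀ k, u k < ε := fun k => by
    rw [hu]; dsimp only
    rw [div_lt_iff₀ (by positivity)]
    nlinarith [h.pos]
  have hu0 : Tendsto u atTop (𝓝 0) := by
    have h1 : Tendsto (fun k : ℕ => (k : ℝ) + 2) atTop atTop :=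
      tendsto_natCast_atTop_atTop.atTop_add tendsto_const_nhds
    exact tendsto_const_nhds.div_atTop h1
  have hseq : ∀ k : ℕ, ∃ t ∈ Icc (0 : ℝ) 1, ∃ x ∈ (closedShell (u k) : Set E),
      ∃ y ∈ (closedShell (u k) : Set E), ‖B t x - B t y‖ < u k * ‖x - y‖ := fun k =>
    hcon (u k) (u k) (hupos k) (hult k) (hupos k)
  choose t ht x hx y hy hlt using hseq
  -- extract a convergent subsequence in the compact set `[0, 1] × 𝔻 × 𝔻`
  have hK : IsCompact (Icc (0 : ℝ) 1 ×ˢ (closedBall (0 : E) 1 ×ˢ closedBall (0 : E) 1)) :=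
    isCompact_Icc.prod ((isCompact_closedBall 0 1).prod (isCompact_closedBall 0 1))
  have hmemK : ∀ k, (t k, x k, y k) ∈ Icc (0 : ℝ) 1 ×ˢ (closedBall (0 : E) 1 ×ˢ closedBall (0 : E) 1) :=
    fun k => ⟨ht k, closedShell_subset_closedBall (hx k), closedShell_subset_closedBall (hy k)⟩
  obtain ⟨⟨t₀, x₀, y₀⟩, ⟨ht₀, hx₀, hy₀⟩, φ, hφ, hlim⟩ := hK.tendsto_subseq hmemK
  have htlim : Tendsto (fun k => t (φ k)) atTop (𝓝 t₀) := (continuous_fst.tendsto _).comp hlim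
  have hxlim : Tendsto (fun k => x (φ k)) atTop (𝓝 x₀) :=
    (continuous_fst.tendsto _).comp ((continuous_snd.tendsto _).comp hlim)
  have hylim : Tendsto (fun k => y (φ k)) atTop (𝓝 y₀) :=
    (continuous_snd.tendsto _).comp ((continuous_snd.tendsto _).comp hlim)
  have huφ : Tendsto (fun k => u (φ k)) atTop (𝓝 0) := hu0.comp hφ.tendsto_atTop
  -- the limits lie on the sphere
  have norm_lim : ∀ {w : ℕ → E} {w₀ : E}, (∀ k, w k ∈ (closedShell (u k) : Set E)) →
      Tendsto (fun k => w (φ k)) atTop (𝓝 w₀) → ‖w₀‖ = 1 := by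
    intro w w₀ hw hwlim
    have h1 : Tendsto (fun k => ‖w (φ k)‖) atTop (𝓝 ‖w₀‖) := hwlim.norm
    have h2 : Tendsto (fun k => 1 - u (φ k)) atTop (𝓝 1) := by
      simpa using tendsto_const_nhds.sub huφ
    refine le_antisymm ?_ ?_
    · exact le_of_tendsto' h1 fun k => (mem_closedShell_iff.1 (hw (φ k))).2
    · exact le_of_tendsto_of_tendsto' h2 h1 fun k => (mem_closedShell_iff.1 (hw (φ k))).1.le
  have hx₀1 : ‖x₀‖ = 1 := norm_lim hx hxlim
  have hy₀1 : ‖y₀‖ = 1 := norm_lim hy hylim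
  -- `B (t k) (x k) → x₀` and `B (t k) (y k) → y₀`, hence `x₀ = y₀`
  have B_lim : ∀ {w : ℕ → E} {w₀ : E}, (∀ k, w k ∈ (closedShell (u k) : Set E)) →
      Tendsto (fun k => w (φ k)) atTop (𝓝 w₀) → ‖w₀‖ = 1 →
      Tendsto (fun k => B (t (φ k)) (w (φ k))) atTop (𝓝 w₀) := by
    intro w w₀ hw hwlim hw₀
    have hws : Tendsto (fun k => w (φ k)) atTop (𝓝[s] w₀) :=
      tendsto_nhdsWithin_iff.2 ⟨hwlim, Eventually.of_forall fun k =>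
        closedShell_mono (hult _).le (hw (φ k))⟩
    have hθw : Tendsto (fun k => θ (w (φ k))) atTop (𝓝 w₀) := by
      have := (h.continuousWithinAt (h.mem_closedShell_of_norm_eq_one hw₀)).tendsto.comp hws
      rwa [h.eq_self w₀ hw₀] at this
    have : Tendsto (fun k => w (φ k) + t (φ k) • (θ (w (φ k)) - w (φ k))) atTop
        (𝓝 (w₀ + t₀ • (w₀ - w₀))) := hwlim.add (htlim.smul (hθw.sub hwlim))
    simpa [hB] using this
  have hxy₀ : x₀ = y₀ := by
    have hd : Tendsto (fun k => B (t (φ k)) (x (φ k)) - B (t (φ k)) (y (φ k))) atTop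
        (𝓝 (x₀ - y₀)) := (B_lim hx hxlim hx₀1).sub (B_lim hy hylim hy₀1)
    have hd0 : Tendsto (fun k => B (t (φ k)) (x (φ k)) - B (t (φ k)) (y (φ k))) atTop (𝓝 0) := by
      refine squeeze_zero_norm (fun k => ?_) (by simpa using huφ.mul_const (2 : ℝ))
      refine (hlt (φ k)).le.trans ?_
      gcongr
      · exact (hupos _).le
      · calc ‖x (φ k) - y (φ k)‖ ≤ ‖x (φ k)‖ + ‖y (φ k)‖ := norm_sub_le _ _
          _ ≤ 1 + 1 := add_le_add (mem_closedShell_iff.1 (hx _)).2 (mem_closedShell_iff.1 (hy _)).2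
          _ = 2 := by norm_num
    exact sub_eq_zero.1 (tendsto_nhds_unique hd hd0)
  subst hxy₀
  -- the limit linear map `M₀ = (1 - t₀) I + t₀ Dθ_{x₀}` is invertible, with lower bound `c₀`
  set L₀ := fderivWithin ℝ θ s x₀ with hL₀
  set M₀ : E →L[ℝ] E := (1 - t₀) • ContinuousLinearMap.id ℝ E + t₀ • L₀ with hM₀
  have hM₀inj : Injective M₀ := h.injective_convexCombination hx₀1 ht₀
  set M₀e : E ≃L[ℝ] E :=
    (LinearEquiv.ofInjectiveEndo (M₀ : E →ₗ[ℝ] E) hM₀inj).toContinuousLinearEquiv with hM₀e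
  have hM₀e_apply : ∀ w, M₀e w = M₀ w := fun w => rfl
  set K₀ : ℝ := ‖(M₀e.symm : E →L[ℝ] E)‖ with hK₀
  set c₀ : ℝ := (K₀ + 1)⁻¹ with hc₀
  have hc₀pos : 0 < c₀ := by positivity
  have hlow : ∀ w : E, c₀ * ‖w‖ ≤ ‖M₀ w‖ := by
    intro w
    have h1 : ‖w‖ ≤ K₀ * ‖M₀ w‖ := by
      calc ‖w‖ = ‖(M₀e.symm : E →L[ℝ] E) (M₀e w)‖ := by rw [ContinuousLinearEquiv.coe_coe,
              ContinuousLinearEquiv.symm_apply_apply]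
        _ ≤ K₀ * ‖M₀e w‖ := (M₀e.symm : E →L[ℝ] E).le_opNorm _
        _ = K₀ * ‖M₀ w‖ := by rw [hM₀e_apply]
    rw [hc₀, inv_mul_le_iff₀ (by positivity)]
    nlinarith [norm_nonneg (M₀ w), norm_nonneg w, norm_nonneg (M₀e.symm : E →L[ℝ] E)]
  -- continuity of the derivative at `x₀` within the shell
  have hx₀s : x₀ ∈ s := h.mem_closedShell_of_norm_eq_one hx₀1
  obtain ⟨r₁, hr₁pos, hr₁⟩ : ∃ r₁ > 0, ∀ z ∈ s, dist z x₀ < r₁ → dist (fderivWithin ℝ θ s z) L₀ < c₀ / 8 :=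
    Metric.continuousWithinAt_iff.1 (h.continuousOn_fderivWithin x₀ hx₀s) (c₀ / 8) (by positivity)
  set r₂ : ℝ := c₀ / (4 * (1 + ‖L₀‖)) with hr₂
  have hr₂pos : 0 < r₂ := by positivity
  -- the derivative of `B τ` stays within `c₀ / 2` of `M₀` for `|τ - t₀| < r₂`, `z ∈ s` near `x₀`
  have hnear : ∀ τ ∈ Icc (0 : ℝ) 1, |τ - t₀| < r₂ → ∀ z ∈ s, dist z x₀ < r₁ →
      ‖((1 - τ) • ContinuousLinearMap.id ℝ E + τ • fderivWithin ℝ θ s z) - M₀‖ ≤ c₀ / 2 := by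
    intro τ hτ hτt z hz hzx
    have hD : ‖fderivWithin ℝ θ s z - L₀‖ < c₀ / 8 := by rw [← dist_eq_norm]; exact hr₁ z hz hzx
    have hdecomp : ((1 - τ) • ContinuousLinearMap.id ℝ E + τ • fderivWithin ℝ θ s z) - M₀ =
        (t₀ - τ) • ContinuousLinearMap.id ℝ E + τ • (fderivWithin ℝ θ s z - L₀) + (τ - t₀) • L₀ := by
      rw [hM₀]; module
    rw [hdecomp]
    calc ‖(t₀ - τ) • ContinuousLinearMap.id ℝ E + τ • (fderivWithin ℝ θ s z - L₀) + (τ - t₀) • L₀‖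
        ≤ ‖(t₀ - τ) • ContinuousLinearMap.id ℝ E‖ + ‖τ • (fderivWithin ℝ θ s z - L₀)‖ +
            ‖(τ - t₀) • L₀‖ := norm_add₃_le
      _ ≤ |t₀ - τ| * 1 + |τ| * (c₀ / 8) + |τ - t₀| * ‖L₀‖ := by
          rw [norm_smul, norm_smul, norm_smul, Real.norm_eq_abs, Real.norm_eq_abs, Real.norm_eq_abs]
          gcongr
          all_goals exact ContinuousLinearMap.norm_id_le
      _ ≤ r₂ * 1 + 1 * (c₀ / 8) + r₂ * ‖L₀‖ := by
          gcongr
          all_goals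
            first
              | exact hτt.le
              | (rw [abs_sub_comm]; exact hτt.le)
              | (rw [abs_le]; exact ⟨by linarith [hτ.1], hτ.2⟩)
      _ = r₂ * (1 + ‖L₀‖) + c₀ / 8 := by ring
      _ = c₀ / 4 + c₀ / 8 := by rw [hr₂]; field_simp
      _ ≤ c₀ / 2 := by linarith
  -- the convex set `K = 𝔻 ∩ B(x₀, r)` with `r = min r₁ ε` lies in the shell
  set r : ℝ := min r₁ ε with hr
  have hrpos : 0 < r := lt_min hr₁pos h.pos
  set K : Set E := closedBall (0 : E) 1 ∩ ball x₀ r with hKdef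
  have hKconv : Convex ℝ K := (convex_closedBall 0 1).inter (convex_ball x₀ r)
  have hKs : K ⊆ s := by
    intro z hz
    refine mem_closedShell_iff.2 ⟨?_, mem_closedBall_zero_iff.1 hz.1⟩
    have h1 : ‖z - x₀‖ < r := by rw [← dist_eq_norm]; exact hz.2
    have h2 : ‖x₀‖ - ‖z - x₀‖ ≤ ‖z‖ := by
      have := norm_sub_norm_le x₀ (x₀ - z)
      rw [sub_sub_cancel, norm_sub_rev] at this
      linarith
    linarith [min_le_right r₁ ε]
  -- on `K`, each `B τ` with `|τ - t₀| < r₂` is `c₀/2`-expanding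
  have hexpand : ∀ τ ∈ Icc (0 : ℝ) 1, |τ - t₀| < r₂ → ∀ a ∈ K, ∀ b ∈ K,
      c₀ / 2 * ‖a - b‖ ≤ ‖B τ a - B τ b‖ := by
    intro τ hτ hτt a ha b hb
    have hg : ∀ z ∈ K, HasFDerivWithinAt (fun y => B τ y - M₀ y)
        (((1 - τ) • ContinuousLinearMap.id ℝ E + τ • fderivWithin ℝ θ s z) - M₀) K z := by
      intro z hz
      exact ((h.hasFDerivWithinAt_blend τ (hKs hz)).sub M₀.hasFDerivWithinAt).mono hKs
    have hgb : ∀ z ∈ K, ‖((1 - τ) • ContinuousLinearMap.id ℝ E + τ • fderivWithin ℝ θ s z) - M₀‖ ≤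
        c₀ / 2 := fun z hz => hnear τ hτ hτt z (hKs hz) (lt_of_lt_of_le hz.2 (min_le_left _ _))
    have hmvt := hKconv.norm_image_sub_le_of_norm_hasFDerivWithin_le hg hgb hb ha
    -- `‖B a - B b‖ ≥ ‖M₀ (a - b)‖ - ‖(B a - M₀ a) - (B b - M₀ b)‖`
    have h1 : B τ a - B τ b = M₀ (a - b) + ((B τ a - M₀ a) - (B τ b - M₀ b)) := by
      rw [map_sub]; abel
    calc c₀ / 2 * ‖a - b‖ = c₀ * ‖a - b‖ - c₀ / 2 * ‖a - b‖ := by ring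
      _ ≤ ‖M₀ (a - b)‖ - ‖(B τ a - M₀ a) - (B τ b - M₀ b)‖ := by
          gcongr
          · exact hlow (a - b)
      _ ≤ ‖B τ a - B τ b‖ := by
          rw [h1]
          have := norm_sub_norm_le (M₀ (a - b)) (-(((B τ a - M₀ a) - (B τ b - M₀ b))))
          rw [sub_neg_eq_add, norm_neg] at this
          linarith
  -- choose `k` large: `t (φ k)` near `t₀`, `x (φ k), y (φ k)` near `x₀`, `u (φ k) < c₀ / 2`
  have ev_t : ∀ᶠ k in atTop, |t (φ k) - t₀| < r₂ := by
    have := (Metric.tendsto_nhds.1 htlim) r₂ hr₂pos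
    simpa only [Real.dist_eq] using this
  have ev_x : ∀ᶠ k in atTop, dist (x (φ k)) x₀ < r := (Metric.tendsto_nhds.1 hxlim) r hrpos
  have ev_y : ∀ᶠ k in atTop, dist (y (φ k)) x₀ < r := (Metric.tendsto_nhds.1 hylim) r hrpos
  have ev_u : ∀ᶠ k in atTop, u (φ k) < c₀ / 2 := by
    have := (Metric.tendsto_nhds.1 huφ) (c₀ / 2) (by positivity)
    filter_upwards [this] with k hk
    rw [Real.dist_eq, sub_zero, abs_of_pos (hupos _)] at hk
    exact hk
  obtain ⟨k, hk⟩ := (((ev_t.and ev_x).and ev_y).and ev_u).exists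
  obtain ⟨⟨⟨hkt, hkx⟩, hky⟩, hku⟩ := hk
  have hxK : x (φ k) ∈ K := ⟨closedShell_subset_closedBall (hx _), hkx⟩
  have hyK : y (φ k) ∈ K := ⟨closedShell_subset_closedBall (hy _), hky⟩
  have hge := hexpand (t (φ k)) (ht _) hkt (x (φ k)) hxK (y (φ k)) hyK
  have hlt' := hlt (φ k)
  have hne : 0 < ‖x (φ k) - y (φ k)‖ := by
    rcases (norm_nonneg (x (φ k) - y (φ k))).eq_or_lt with h0 | h0
    · rw [← h0, mul_zero] at hlt'
      exact absurd hlt' (not_lt.2 (norm_nonneg _))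
    · exact h0
  have : c₀ / 2 * ‖x (φ k) - y (φ k)‖ < u (φ k) * ‖x (φ k) - y (φ k)‖ := hge.trans_lt hlt'
  have := lt_of_mul_lt_mul_right this (norm_nonneg _)
  linarith

/-! #### Lower bound for the derivatives of the blends -/

omit [FiniteDimensional ℝ E] in
/-- From the uniform lower bound on the blends, a lower bound for their derivatives
`(1 - t) I + t Dθ_x` at interior points of the small shell. [folklore] -/
theorem lower_bound_convexCombination (h : IsInnerCollar ε θ θinv) {ε₃ c : ℝ} (hε₃ : ε₃ ≤ ε)
    (hco : ∀ t ∈ Icc (0 : ℝ) 1, ∀ x ∈ (closedShell ε₃ : Set E), ∀ y ∈ (closedShell ε₃ : Set E),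
      c * ‖x - y‖ ≤ ‖(x + t • (θ x - x)) - (y + t • (θ y - y))‖)
    {t : ℝ} (ht : t ∈ Icc (0 : ℝ) 1) {x : E} (hx : x ∈ (openShell ε₃ : Set E)) (w : E) :
    c * ‖w‖ ≤ ‖((1 - t) • ContinuousLinearMap.id ℝ E + t • fderivWithin ℝ θ (closedShell ε) x) w‖ := by
  set B : E → E := fun y => y + t • (θ y - y) with hB
  set M := (1 - t) • ContinuousLinearMap.id ℝ E + t • fderivWithin ℝ θ (closedShell ε) x with hM
  have hxε : x ∈ (openShell ε : Set E) := openShell_mono hε₃ hx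
  have hd : HasFDerivAt B M x :=
    (h.hasFDerivWithinAt_blend t (openShell_subset_closedShell hxε)).hasFDerivAt
      (mem_of_superset (openShell_mem_nhds hxε) openShell_subset_closedShell)
  -- difference quotients along `w`
  have hlim := hd.lim w (c := fun n : ℕ => (n : ℝ)) (l := atTop)
    (by simpa using tendsto_natCast_atTop_atTop)
  have hnorm : Tendsto (fun n : ℕ => ‖(n : ℝ) • (B (x + ((n : ℝ))⁻¹ • w) - B x)‖) atTop (𝓝 ‖M w‖) :=
    hlim.norm
  -- eventually `x + n⁻¹ w` lies in the small closed shell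
  have hev : ∀ᶠ n : ℕ in atTop, x + ((n : ℝ))⁻¹ • w ∈ (closedShell ε₃ : Set E) := by
    have h1 : Tendsto (fun n : ℕ => x + ((n : ℝ))⁻¹ • w) atTop (𝓝 x) := by
      have : Tendsto (fun n : ℕ => ((n : ℝ))⁻¹ • w) atTop (𝓝 ((0 : ℝ) • w)) :=
        tendsto_inv_atTop_nhds_zero_nat.smul_const w
      simpa using tendsto_const_nhds.add this
    exact (h1.eventually (openShell_mem_nhds hx)).mono fun n hn => openShell_subset_closedShell hn
  have hev' : ∀ᶠ n : ℕ in atTop, c * ‖w‖ ≤ ‖(n : ℝ) • (B (x + ((n : ℝ))⁻¹ • w) - B x)‖ := by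
    filter_upwards [hev, eventually_gt_atTop 0] with n hn hn0
    have hnpos : (0 : ℝ) < n := by exact_mod_cast hn0
    have := hco t ht _ hn x (openShell_subset_closedShell hx)
    rw [add_sub_cancel_left, norm_smul, norm_inv, Real.norm_of_nonneg hnpos.le] at this
    rw [norm_smul, Real.norm_of_nonneg hnpos.le]
    calc c * ‖w‖ = (n : ℝ) * (c * ((n : ℝ)⁻¹ * ‖w‖)) := by field_simp
      _ ≤ (n : ℝ) * ‖B (x + ((n : ℝ))⁻¹ • w) - B x‖ := by gcongr
  exact ge_of_tendsto hnorm hev'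

/-! #### The splice -/

/-- **The splice** `Θ_L x = x + ρ_L (1 - ‖x‖) • (θ x - x)` of the collar `θ` (near the sphere)
with the identity (inside), along the log-slow cutoff `ρ_L = logCutoff L`. [folklore] -/
def splice (θ : E → E) (L : ℝ) (x : E) : E := x + logCutoff L (1 - ‖x‖) • (θ x - x)

omit [FiniteDimensional ℝ E] in
/-- Unfolding the splice. [folklore] -/
theorem splice_apply (θ : E → E) (L : ℝ) (x : E) :
    splice θ L x = x + logCutoff L (1 - ‖x‖) • (θ x - x) := rfl

omit [FiniteDimensional ℝ E] in
/-- Deep inside (`‖x‖ ≤ 1 - e^{-L}`) the splice is the identity. [folklore] -/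
theorem splice_eq_self {L : ℝ} (hL : 0 < L) {x : E} (hx : ‖x‖ ≤ 1 - exp (-L)) :
    splice θ L x = x := by
  rw [splice_apply, logCutoff_eq_zero hL (by linarith), zero_smul, add_zero]

omit [FiniteDimensional ℝ E] in
/-- Near the sphere (`1 - e^{-2L} ≤ ‖x‖ < 1`) the splice is the collar. [folklore] -/
theorem splice_eq {L : ℝ} (hL : 0 < L) {x : E} (h1 : 1 - exp (-2 * L) ≤ ‖x‖) (h2 : ‖x‖ < 1) :
    splice θ L x = θ x := by
  rw [splice_apply, logCutoff_eq_one hL (by linarith) (by linarith), one_smul, add_sub_cancel]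

omit [FiniteDimensional ℝ E] in
/-- On the sphere the splice is the identity (like `θ`). [folklore] -/
theorem splice_eq_self_of_norm_eq_one (h : IsInnerCollar ε θ θinv) (L : ℝ) {x : E}
    (hx : ‖x‖ = 1) : splice θ L x = x := by
  rw [splice_apply, h.eq_self x hx, sub_self, smul_zero, add_zero]

omit [FiniteDimensional ℝ E] in
/-- The splice is a convex combination of `x` and `θ x`; it maps the open ball into itself.
[folklore] -/
theorem norm_splice_lt_one (h : IsInnerCollar ε θ θinv) {L : ℝ} (hL : 0 < L) (hLε : exp (-L) < ε)
    {x : E} (hx : ‖x‖ < 1) : ‖splice θ L x‖ < 1 := by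
  by_cases hx' : ‖x‖ ≤ 1 - exp (-L)
  · rwa [splice_eq_self hL hx']
  · have hxo : x ∈ (openShell ε : Set E) := mem_openShell_iff.2 ⟨by linarith [not_le.1 hx'], hx⟩
    have hθ : ‖θ x‖ < 1 := mem_ball_zero_iff.1 (h.mapsTo_ball hxo)
    have hconv : splice θ L x = (1 - logCutoff L (1 - ‖x‖)) • x + logCutoff L (1 - ‖x‖) • θ x := by
      rw [splice_apply, smul_sub, sub_smul, one_smul]; abel
    rw [hconv]
    exact mem_ball_zero_iff.1 ((convex_ball (0 : E) 1) (mem_ball_zero_iff.2 hx)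
      (mem_ball_zero_iff.2 hθ) (sub_nonneg.2 (logCutoff_le_one _ _)) (logCutoff_nonneg _ _)
      (sub_add_cancel _ _))

omit [FiniteDimensional ℝ E] in
/-- The splice is `C^∞` on the open unit ball (for `e^{-L} < ε`). [folklore] -/
theorem contDiffAt_splice (h : IsInnerCollar ε θ θinv) {L : ℝ} (hL : 0 < L) (hLε : exp (-L) < ε)
    {x : E} (hx : ‖x‖ < 1) : ContDiffAt ℝ ∞ (splice θ L) x := by
  by_cases hx' : ‖x‖ < 1 - exp (-L)
  · -- the splice is the identity near `x`
    have hev : splice θ L =ᶠ[𝓝 x] fun y => y := by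
      filter_upwards [(isOpen_lt continuous_norm continuous_const).mem_nhds hx'] with y hy
      exact splice_eq_self hL hy.le
    exact contDiffAt_id.congr_of_eventuallyEq hev
  · have hxn : 1 - exp (-L) ≤ ‖x‖ := not_lt.1 hx'
    have hxo : x ∈ (openShell ε : Set E) := mem_openShell_iff.2 ⟨by linarith, hx⟩
    have hx0 : x ≠ 0 := by
      rintro rfl
      rw [norm_zero] at hxn
      linarith [exp_lt_one_iff.2 (neg_lt_zero.2 hL)]  -- `exp (-L) < 1`
    have hθ : ContDiffAt ℝ ∞ θ x := h.contDiffAt hxo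
    have hn : ContDiffAt ℝ ∞ (fun y : E => ‖y‖) x := contDiffAt_norm ℝ hx0
    have hρ : ContDiffAt ℝ ∞ (fun y : E => logCutoff L (1 - ‖y‖)) x :=
      (contDiffAt_logCutoff (by linarith)).comp x (contDiffAt_const.sub hn)
    exact contDiffAt_id.add (hρ.smul (hθ.sub contDiffAt_id))

omit [FiniteDimensional ℝ E] in
/-- **Derivative of the splice on the shell**: `DΘ_x = [(1 - ρ) I + ρ Dθ_x] + R` with
`‖R‖ ≤ |ρ'(t)| ‖θ x - x‖`, `t = 1 - ‖x‖`, `ρ = ρ_L t`. [folklore] -/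
theorem hasFDerivAt_splice (h : IsInnerCollar ε θ θinv) (L : ℝ) {x : E}
    (hxo : x ∈ (openShell ε : Set E)) (hx0 : x ≠ 0) :
    ∃ R : E →L[ℝ] E, ‖R‖ ≤ |deriv (logCutoff L) (1 - ‖x‖)| * ‖θ x - x‖ ∧
      HasFDerivAt (splice θ L)
        (((1 - logCutoff L (1 - ‖x‖)) • ContinuousLinearMap.id ℝ E +
          logCutoff L (1 - ‖x‖) • fderivWithin ℝ θ (closedShell ε) x) + R) x := by
  have ht0 : 1 - ‖x‖ ≠ 0 := by linarith [(mem_openShell_iff.1 hxo).2]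
  -- derivative of `y ↦ 1 - ‖y‖`
  set N : E →L[ℝ] ℝ := fderiv ℝ (fun y : E => ‖y‖) x with hN
  have hn : HasFDerivAt (fun y : E => ‖y‖) N x :=
    ((contDiffAt_norm ℝ hx0 (n := 1)).differentiableAt one_ne_zero).hasFDerivAt
  have hN1 : ‖N‖ ≤ 1 := by
    have := norm_fderiv_le_of_lipschitz ℝ (lipschitzWith_one_norm (E := E)) (x₀ := x)
    simpa using this
  set ρ' : ℝ := deriv (logCutoff L) (1 - ‖x‖) with hρ'
  have hg : HasFDerivAt (fun y : E => logCutoff L (1 - ‖y‖)) (ρ' • (-N)) x := by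
    have h1 : HasFDerivAt (fun y : E => 1 - ‖y‖) (-N) x := by
      simpa using hn.const_sub 1
    have h2 : HasDerivAt (logCutoff L) ρ' (1 - ‖x‖) :=
      (hasDerivAt_logCutoff ht0).differentiableAt.hasDerivAt
    have h3 := h2.comp_hasFDerivAt x h1
    exact h3
  -- derivative of `θ - id` at the interior point `x`
  have hφ : HasFDerivAt (fun y : E => θ y - y)
      (fderivWithin ℝ θ (closedShell ε) x - ContinuousLinearMap.id ℝ E) x :=
    (h.hasFDerivAt hxo).sub (hasFDerivAt_id x)
  have hprod := hg.smul hφ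
  have hsum := (hasFDerivAt_id x).add hprod
  refine ⟨(ρ' • (-N)).smulRight (θ x - x), ?_, ?_⟩
  · rw [ContinuousLinearMap.norm_smulRight_apply, norm_smul, norm_neg, Real.norm_eq_abs]
    calc |ρ'| * ‖N‖ * ‖θ x - x‖ ≤ |ρ'| * 1 * ‖θ x - x‖ := by gcongr
      _ = |ρ'| * ‖θ x - x‖ := by rw [mul_one]
  · have heq : ((1 - logCutoff L (1 - ‖x‖)) • ContinuousLinearMap.id ℝ E +
          logCutoff L (1 - ‖x‖) • fderivWithin ℝ θ (closedShell ε) x) +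
          (ρ' • (-N)).smulRight (θ x - x) =
        ContinuousLinearMap.id ℝ E +
          (logCutoff L (1 - ‖x‖) • (fderivWithin ℝ θ (closedShell ε) x -
            ContinuousLinearMap.id ℝ E) + (ρ' • (-N)).smulRight (θ x - x)) := by
      module
    rw [heq]
    exact hsum

/-! #### Choice of the parameters -/

/-- The numerical hypotheses under which the splice `Θ_L` is a diffeomorphism of the open ball:
a width `ε₃ < ε` with a uniform lower bound `c` for the blends and a radial Lipschitz constant
`C₁` on the shell of width `ε₃`, and `L` so large that the transition region `{e^{-2L} ≤ t ≤ e^{-L}}`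
lies well inside that shell and `C₀ C₁ / L ≤ c / 2`. [folklore] -/
structure SpliceHyp (ε : ℝ) (θ : E → E) (ε₃ c C₁ L : ℝ) : Prop where
  ε₃_pos : 0 < ε₃
  ε₃_lt : ε₃ < ε
  c_pos : 0 < c
  C₁_pos : 0 < C₁
  lower : ∀ t ∈ Icc (0 : ℝ) 1, ∀ x ∈ (closedShell ε₃ : Set E), ∀ y ∈ (closedShell ε₃ : Set E),
    c * ‖x - y‖ ≤ ‖(x + t • (θ x - x)) - (y + t • (θ y - y))‖
  radial : ∀ x ∈ (closedShell ε₃ : Set E), ‖θ x - x‖ ≤ C₁ * (1 - ‖x‖)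
  L_pos : 0 < L
  exp_lt : (1 + C₁) * exp (-L) < ε₃
  quot_le : smoothTransitionDerivBound * C₁ / L ≤ c / 2

/-- The parameters exist. [folklore] -/
theorem exists_spliceHyp (h : IsInnerCollar ε θ θinv) :
    ∃ ε₃ c C₁ L : ℝ, SpliceHyp ε θ ε₃ c C₁ L := by
  obtain ⟨ε₃, c, hε₃, hε₃ε, hc, hlow⟩ := h.exists_lower_bound_blend
  obtain ⟨C₁, hC₁, hrad⟩ := h.exists_norm_sub_self_le hε₃ε
  -- `L → ∞`: both smallness conditions hold eventually
  have ev1 : ∀ᶠ L : ℝ in atTop, (1 + C₁) * exp (-L) < ε₃ := by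
    have : Tendsto (fun L : ℝ => (1 + C₁) * exp (-L)) atTop (𝓝 ((1 + C₁) * 0)) :=
      tendsto_exp_neg_atTop_nhds_zero.const_mul _
    rw [mul_zero] at this
    exact this.eventually (eventually_lt_nhds hε₃)
  have ev2 : ∀ᶠ L : ℝ in atTop, smoothTransitionDerivBound * C₁ / L ≤ c / 2 := by
    have : Tendsto (fun L : ℝ => smoothTransitionDerivBound * C₁ / L) atTop (𝓝 0) :=
      tendsto_const_nhds.div_atTop tendsto_id
    exact (this.eventually (eventually_lt_nhds (by positivity : (0 : ℝ) < c / 2))).mono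
      fun L hL => le_of_lt hL
  obtain ⟨L, hL⟩ := ((ev1.and ev2).and (eventually_gt_atTop 0)).exists
  obtain ⟨⟨hL1, hL2⟩, hL0⟩ := hL
  exact ⟨ε₃, c, C₁, L, ⟨hε₃, hε₃ε, hc, hC₁, hlow, hrad, hL0, hL1, hL2⟩⟩

namespace SpliceHyp

variable {ε₃ c C₁ L : ℝ}

omit [FiniteDimensional ℝ E] in
/-- The transition depth `e^{-L}` is below the width `ε₃`. [folklore] -/
theorem exp_lt_ε₃ (hs : SpliceHyp ε θ ε₃ c C₁ L) : exp (-L) < ε₃ := by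
  have : exp (-L) ≤ (1 + C₁) * exp (-L) :=
    le_mul_of_one_le_left (exp_pos _).le (by linarith [hs.C₁_pos])
  exact this.trans_lt hs.exp_lt

omit [FiniteDimensional ℝ E] in
/-- The transition depth `e^{-L}` is below the width `ε`. [folklore] -/
theorem exp_lt_ε (hs : SpliceHyp ε θ ε₃ c C₁ L) : exp (-L) < ε := hs.exp_lt_ε₃.trans hs.ε₃_lt

omit [FiniteDimensional ℝ E] in
/-- `e^{-L} < 1`. [folklore] -/
theorem exp_lt_one (hs : SpliceHyp ε θ ε₃ c C₁ L) : exp (-L) < 1 :=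
  Real.exp_lt_one_iff.2 (neg_lt_zero.2 hs.L_pos)

omit [FiniteDimensional ℝ E] in
/-- `‖Θ x - x‖ ≤ C₁ (1 - ‖x‖)` on the shell of width `ε₃`. [folklore] -/
theorem norm_splice_sub_self_le (hs : SpliceHyp ε θ ε₃ c C₁ L) {x : E}
    (hx : x ∈ (closedShell ε₃ : Set E)) : ‖splice θ L x - x‖ ≤ C₁ * (1 - ‖x‖) := by
  rw [splice_apply, add_sub_cancel_left, norm_smul, Real.norm_of_nonneg (logCutoff_nonneg _ _)]
  calc logCutoff L (1 - ‖x‖) * ‖θ x - x‖ ≤ 1 * ‖θ x - x‖ := by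
        gcongr; exact logCutoff_le_one _ _
    _ ≤ C₁ * (1 - ‖x‖) := by rw [one_mul]; exact hs.radial x hx

omit [FiniteDimensional ℝ E] in
/-- **The derivative of the splice is uniformly injective on the open ball**: at every point of
the open unit ball the splice has a derivative `D` with `m ‖w‖ ≤ ‖D w‖`, `m = min (c/2) 1 > 0`.
[folklore] -/
theorem exists_hasFDerivAt_lower (h : IsInnerCollar ε θ θinv) (hs : SpliceHyp ε θ ε₃ c C₁ L)
    {x : E} (hx : ‖x‖ < 1) :
    ∃ D : E →L[ℝ] E, HasFDerivAt (splice θ L) D x ∧ ∀ w, min (c / 2) 1 * ‖w‖ ≤ ‖D w‖ := by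
  by_cases hx' : ‖x‖ < 1 - exp (-L)
  · -- identity near `x`
    refine ⟨ContinuousLinearMap.id ℝ E, ?_, fun w => ?_⟩
    · have hev : splice θ L =ᶠ[𝓝 x] fun y => y := by
        filter_upwards [(isOpen_lt continuous_norm continuous_const).mem_nhds hx'] with y hy
        exact splice_eq_self hs.L_pos hy.le
      exact (hasFDerivAt_id x).congr_of_eventuallyEq hev
    · rw [ContinuousLinearMap.id_apply]
      exact (mul_le_of_le_one_left (norm_nonneg _) (min_le_right _ _))
  · have hxn : 1 - exp (-L) ≤ ‖x‖ := not_lt.1 hx'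
    have hx3 : x ∈ (openShell ε₃ : Set E) := mem_openShell_iff.2 ⟨by linarith [hs.exp_lt_ε₃], hx⟩
    have hxo : x ∈ (openShell ε : Set E) := openShell_mono hs.ε₃_lt.le hx3
    have hx0 : x ≠ 0 := by
      rintro rfl
      rw [norm_zero] at hxn
      linarith [hs.exp_lt_one]
    obtain ⟨R, hR, hD⟩ := h.hasFDerivAt_splice L hxo hx0
    refine ⟨_, hD, fun w => ?_⟩
    set t : ℝ := 1 - ‖x‖ with ht
    have htpos : 0 < t := by rw [ht]; linarith
    set M := (1 - logCutoff L t) • ContinuousLinearMap.id ℝ E +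
      logCutoff L t • fderivWithin ℝ θ (closedShell ε) x with hM
    -- lower bound for `M w` and upper bound for `R w`
    have hMw : c * ‖w‖ ≤ ‖M w‖ :=
      h.lower_bound_convexCombination hs.ε₃_lt.le hs.lower (t := logCutoff L t)
        (logCutoff_mem_Icc L t) hx3 w
    have hRn : ‖R‖ ≤ c / 2 := by
      calc ‖R‖ ≤ |deriv (logCutoff L) t| * ‖θ x - x‖ := hR
        _ ≤ |deriv (logCutoff L) t| * (C₁ * t) := by
            gcongr; exact hs.radial x (openShell_subset_closedShell hx3)
        _ = C₁ * |t * deriv (logCutoff L) t| := by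
            rw [abs_mul, abs_of_pos htpos]; ring
        _ ≤ C₁ * (smoothTransitionDerivBound / L) := by
            gcongr
            · exact hs.C₁_pos.le
            · exact abs_mul_deriv_logCutoff_le hs.L_pos htpos.ne'
        _ = smoothTransitionDerivBound * C₁ / L := by ring
        _ ≤ c / 2 := hs.quot_le
    have hRw : ‖R w‖ ≤ c / 2 * ‖w‖ := (R.le_opNorm w).trans (by gcongr)
    calc min (c / 2) 1 * ‖w‖ ≤ c / 2 * ‖w‖ := by gcongr; exact min_le_left _ _
      _ = c * ‖w‖ - c / 2 * ‖w‖ := by ring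
      _ ≤ ‖M w‖ - ‖R w‖ := by gcongr
      _ ≤ ‖M w + R w‖ := by
          have := norm_sub_norm_le (M w) (-(R w))
          rw [sub_neg_eq_add, norm_neg] at this
          linarith
      _ = ‖(M + R) w‖ := rfl

/-- At every point of the open ball the splice has an invertible strict derivative. [folklore] -/
theorem exists_hasStrictFDerivAt (h : IsInnerCollar ε θ θinv) (hs : SpliceHyp ε θ ε₃ c C₁ L)
    {x : E} (hx : ‖x‖ < 1) :
    ∃ D : E ≃L[ℝ] E, HasStrictFDerivAt (splice θ L) (D : E →L[ℝ] E) x := by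
  obtain ⟨D, hD, hlow⟩ := exists_hasFDerivAt_lower h hs hx
  have hm : 0 < min (c / 2) 1 := lt_min (by linarith [hs.c_pos]) one_pos
  have hinj : Injective D := by
    refine (injective_iff_map_eq_zero D).2 fun w hw => ?_
    have h1 := hlow w
    rw [hw, norm_zero] at h1
    have h2 : ‖w‖ ≤ 0 := by
      by_contra hpos
      exact absurd h1 (not_le.2 (mul_pos hm (lt_of_not_ge hpos)))
    exact norm_eq_zero.1 (le_antisymm h2 (norm_nonneg _))
  set De : E ≃L[ℝ] E :=
    (LinearEquiv.ofInjectiveEndo (D : E →ₗ[ℝ] E) hinj).toContinuousLinearEquiv with hDe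
  have hDe' : (De : E →L[ℝ] E) = D := by
    ext w
    rfl
  refine ⟨De, ?_⟩
  rw [hDe']
  exact (h.contDiffAt_splice hs.L_pos hs.exp_lt_ε hx).hasStrictFDerivAt' hD (by simp)

/-! #### Injectivity of the splice on the open ball -/

omit [FiniteDimensional ℝ E] in
/-- The core of the injectivity argument: two points of the small shell with the same image are
equal (uniform lower bound for the blends + log-Lipschitz bound for the cutoff). [folklore] -/
theorem eq_of_splice_eq_of_mem_shell (hs : SpliceHyp ε θ ε₃ c C₁ L) {x y : E}
    (hx : x ∈ (closedShell ε₃ : Set E)) (hy : y ∈ (closedShell ε₃ : Set E)) (hx1 : ‖x‖ < 1)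
    (hy1 : ‖y‖ < 1) (hxy : splice θ L x = splice θ L y) : x = y := by
  set tx : ℝ := 1 - ‖x‖ with htx
  set ty : ℝ := 1 - ‖y‖ with hty
  have htxpos : 0 < tx := by rw [htx]; linarith
  have htypos : 0 < ty := by rw [hty]; linarith
  set lam : ℝ := logCutoff L tx with hlam
  set mu : ℝ := logCutoff L ty with hmu
  -- the two blends `B_lam`, `B_mu`
  have hBx : splice θ L x = x + lam • (θ x - x) := rfl
  have hBy : splice θ L y = y + mu • (θ y - y) := rfl
  -- `c ‖x - y‖ ≤ |mu - lam| ‖θ y - y‖` and symmetrically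
  have h1 : c * ‖x - y‖ ≤ |mu - lam| * (C₁ * ty) := by
    have := hs.lower lam (logCutoff_mem_Icc L tx) x hx y hy
    rw [← hBx, hxy, hBy, add_sub_add_left_eq_sub, ← sub_smul, norm_smul, Real.norm_eq_abs] at this
    exact this.trans (mul_le_mul_of_nonneg_left (hs.radial y hy) (abs_nonneg _))
  have h2 : c * ‖x - y‖ ≤ |mu - lam| * (C₁ * tx) := by
    have := hs.lower mu (logCutoff_mem_Icc L ty) x hx y hy
    rw [← hBy, ← hxy, hBx, add_sub_add_left_eq_sub, ← sub_smul, norm_smul, Real.norm_eq_abs] at this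
    exact this.trans (mul_le_mul_of_nonneg_left (hs.radial x hx) (abs_nonneg _))
  have h3 : c * ‖x - y‖ ≤ C₁ * (|mu - lam| * min tx ty) := by
    rw [mul_min_of_nonneg _ _ (abs_nonneg _), mul_min_of_nonneg _ _ hs.C₁_pos.le]
    refine le_min ?_ ?_
    · calc c * ‖x - y‖ ≤ |mu - lam| * (C₁ * tx) := h2
        _ = C₁ * (|mu - lam| * tx) := by ring
    · calc c * ‖x - y‖ ≤ |mu - lam| * (C₁ * ty) := h1
        _ = C₁ * (|mu - lam| * ty) := by ring
  -- `|mu - lam| min(tx, ty) ≤ (C₀ / L) |tx - ty| ≤ (C₀ / L) ‖x - y‖`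
  have hmin : 0 < min tx ty := lt_min htxpos htypos
  have h4 : |mu - lam| * min tx ty ≤ smoothTransitionDerivBound / L * ‖x - y‖ := by
    have ha := abs_logCutoff_sub_logCutoff_le hs.L_pos (a := ty) (b := tx)
    have hb := abs_log_sub_log_le' htypos htxpos
    have hc' : |ty - tx| ≤ ‖x - y‖ := by
      rw [hty, htx, show (1 - ‖y‖) - (1 - ‖x‖) = ‖x‖ - ‖y‖ by ring]
      exact abs_norm_sub_norm_le x y
    calc |mu - lam| * min tx ty
        ≤ (smoothTransitionDerivBound / L * (|ty - tx| / min ty tx)) * min tx ty :=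
          mul_le_mul_of_nonneg_right (ha.trans (mul_le_mul_of_nonneg_left hb
            (div_nonneg smoothTransitionDerivBound_pos.le hs.L_pos.le))) hmin.le
      _ = smoothTransitionDerivBound / L * |ty - tx| := by
          rw [min_comm ty tx]; field_simp
      _ ≤ smoothTransitionDerivBound / L * ‖x - y‖ :=
          mul_le_mul_of_nonneg_left hc' (div_nonneg smoothTransitionDerivBound_pos.le hs.L_pos.le)
  have h5 : c * ‖x - y‖ ≤ c / 2 * ‖x - y‖ :=
    calc c * ‖x - y‖ ≤ C₁ * (smoothTransitionDerivBound / L * ‖x - y‖) :=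
          h3.trans (mul_le_mul_of_nonneg_left h4 hs.C₁_pos.le)
      _ = smoothTransitionDerivBound * C₁ / L * ‖x - y‖ := by ring
      _ ≤ c / 2 * ‖x - y‖ := mul_le_mul_of_nonneg_right hs.quot_le (norm_nonneg _)
  have h6 : ‖x - y‖ ≤ 0 := by nlinarith [hs.c_pos, norm_nonneg (x - y)]
  exact sub_eq_zero.1 (norm_eq_zero.1 (le_antisymm h6 (norm_nonneg _)))

omit [FiniteDimensional ℝ E] in
/-- Injectivity, asymmetric case: a point of the transition region and a deep point cannot have
the same image. [folklore] -/
theorem eq_of_splice_eq_aux (hs : SpliceHyp ε θ ε₃ c C₁ L) {x y : E} (hx1 : ‖x‖ < 1)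
    (hy1 : ‖y‖ < 1) (hx : 1 - exp (-L) < ‖x‖) (hxy : splice θ L x = splice θ L y) : x = y := by
  have hx3 : x ∈ (closedShell ε₃ : Set E) :=
    mem_closedShell_iff.2 ⟨by linarith [hs.exp_lt_ε₃], hx1.le⟩
  by_cases hy : 1 - ε₃ < ‖y‖
  · exact hs.eq_of_splice_eq_of_mem_shell hx3 (mem_closedShell_iff.2 ⟨hy, hy1.le⟩) hx1 hy1 hxy
  · -- `y` is deep: `Θ y = y`, while `Θ x` is within `C₁ (1 - ‖x‖) < C₁ e^{-L}` of `x`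
    exfalso
    have hyn : ‖y‖ ≤ 1 - ε₃ := not_lt.1 hy
    have hΘy : splice θ L y = y := splice_eq_self hs.L_pos (by linarith [hs.exp_lt_ε₃])
    have hd : ‖splice θ L x - x‖ ≤ C₁ * (1 - ‖x‖) := hs.norm_splice_sub_self_le hx3
    rw [hxy, hΘy] at hd
    have h1 : ‖x‖ ≤ ‖y‖ + ‖y - x‖ := by
      have := norm_add_le y (x - y); rwa [add_sub_cancel, norm_sub_rev] at this
    have h2 : C₁ * (1 - ‖x‖) < C₁ * exp (-L) := by
      have := hs.C₁_pos; nlinarith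
    nlinarith [hs.exp_lt, exp_pos (-L)]

omit [FiniteDimensional ℝ E] in
/-- **The splice is injective on the open unit ball.** [folklore] -/
theorem injOn_splice (hs : SpliceHyp ε θ ε₃ c C₁ L) : InjOn (splice θ L) (ball (0 : E) 1) := by
  intro x hx y hy hxy
  rw [mem_ball_zero_iff] at hx hy
  by_cases hx' : 1 - exp (-L) < ‖x‖
  · exact hs.eq_of_splice_eq_aux hx hy hx' hxy
  by_cases hy' : 1 - exp (-L) < ‖y‖
  · exact (hs.eq_of_splice_eq_aux hy hx hy' hxy.symm).symm
  rw [splice_eq_self hs.L_pos (not_lt.1 hx'), splice_eq_self hs.L_pos (not_lt.1 hy')] at hxy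
  exact hxy

/-! #### Surjectivity onto the open ball -/

omit [FiniteDimensional ℝ E] in
/-- The splice maps the open unit ball into itself. [folklore] -/
theorem mapsTo_splice (h : IsInnerCollar ε θ θinv) (hs : SpliceHyp ε θ ε₃ c C₁ L) :
    MapsTo (splice θ L) (ball (0 : E) 1) (ball 0 1) := fun _ hx =>
  mem_ball_zero_iff.2 (h.norm_splice_lt_one hs.L_pos hs.exp_lt_ε (mem_ball_zero_iff.1 hx))

/-- Images of open subsets of the ball under the splice are open (inverse function theorem).
[folklore] -/
theorem isOpen_image_splice (h : IsInnerCollar ε θ θinv) (hs : SpliceHyp ε θ ε₃ c C₁ L)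
    {W : Set E} (hW : IsOpen W) (hWb : W ⊆ ball (0 : E) 1) : IsOpen (splice θ L '' W) := by
  refine isOpen_iff_mem_nhds.2 ?_
  rintro _ ⟨x, hxW, rfl⟩
  obtain ⟨D, hD⟩ := hs.exists_hasStrictFDerivAt h (mem_ball_zero_iff.1 (hWb hxW))
  rw [← hD.map_nhds_eq_of_equiv]
  exact image_mem_map (hW.mem_nhds hxW)

/-- **The splice maps the open unit ball onto itself**: its image is open (inverse function
theorem), closed in the ball (a limit of images `Θ xₖ` with `xₖ → x₀ ∈ 𝕊` would lie on the sphere,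
as `‖Θ xₖ - xₖ‖ ≤ C₁ (1 - ‖xₖ‖) → 0`), and the ball is connected. [folklore] -/
theorem surjOn_splice (h : IsInnerCollar ε θ θinv) (hs : SpliceHyp ε θ ε₃ c C₁ L) :
    SurjOn (splice θ L) (ball (0 : E) 1) (ball 0 1) := by
  set A : Set E := splice θ L '' ball (0 : E) 1 with hA
  have hAopen : IsOpen A := hs.isOpen_image_splice h isOpen_ball Subset.rfl
  have hAne : (ball (0 : E) 1 ∩ A).Nonempty := by
    refine ⟨0, mem_ball_self one_pos, 0, mem_ball_self one_pos, ?_⟩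
    exact splice_eq_self hs.L_pos (by rw [norm_zero]; linarith [hs.exp_lt_one])
  have hAcl : closure A ∩ ball (0 : E) 1 ⊆ A := by
    rintro y ⟨hyc, hyb⟩
    rw [mem_ball_zero_iff] at hyb
    obtain ⟨z, hzA, hzy⟩ := mem_closure_iff_seq_limit.1 hyc
    choose x hxb hxz using hzA
    obtain ⟨x₀, hx₀, φ, hφ, hlim⟩ :=
      (isCompact_closedBall (0 : E) 1).tendsto_subseq fun k => ball_subset_closedBall (hxb k)
    have hzφ : Tendsto (fun k => z (φ k)) atTop (𝓝 y) := hzy.comp hφ.tendsto_atTop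
    have hzx : ∀ k, z (φ k) = splice θ L (x (φ k)) := fun k => (hxz (φ k)).symm
    rw [mem_closedBall_zero_iff] at hx₀
    rcases hx₀.lt_or_eq with hlt | heq
    · -- interior limit: continuity
      have hcont : ContinuousAt (splice θ L) x₀ := (h.contDiffAt_splice hs.L_pos hs.exp_lt_ε hlt).continuousAt
      have h1 : Tendsto (fun k => splice θ L (x (φ k))) atTop (𝓝 (splice θ L x₀)) :=
        hcont.tendsto.comp hlim
      have h2 : Tendsto (fun k => splice θ L (x (φ k))) atTop (𝓝 y) := by
        simpa only [hzx] using hzφ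
      rw [tendsto_nhds_unique h2 h1]
      exact ⟨x₀, mem_ball_zero_iff.2 hlt, rfl⟩
    · -- boundary limit: impossible
      exfalso
      have hnorm : Tendsto (fun k => ‖x (φ k)‖) atTop (𝓝 1) := by rw [← heq]; exact hlim.norm
      have hev : ∀ᶠ k in atTop, x (φ k) ∈ (closedShell ε₃ : Set E) := by
        have : ∀ᶠ k in atTop, 1 - ε₃ < ‖x (φ k)‖ :=
          hnorm.eventually (eventually_gt_nhds (by linarith [hs.ε₃_pos]))
        exact this.mono fun k hk => mem_closedShell_iff.2 ⟨hk, (mem_ball_zero_iff.1 (hxb _)).le⟩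
      have hdiff : Tendsto (fun k => splice θ L (x (φ k)) - x (φ k)) atTop (𝓝 0) := by
        have hb : Tendsto (fun k => C₁ * (1 - ‖x (φ k)‖)) atTop (𝓝 0) := by
          have : Tendsto (fun k => C₁ * (1 - ‖x (φ k)‖)) atTop (𝓝 (C₁ * (1 - 1))) :=
            ((tendsto_const_nhds (x := (1 : ℝ))).sub hnorm).const_mul C₁
          rwa [sub_self, mul_zero] at this
        refine squeeze_zero_norm' ?_ hb
        exact hev.mono fun k hk => hs.norm_splice_sub_self_le hk
      have h1 : Tendsto (fun k => splice θ L (x (φ k))) atTop (𝓝 x₀) := by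
        have := hdiff.add hlim
        simpa using this
      have h2 : Tendsto (fun k => splice θ L (x (φ k))) atTop (𝓝 y) := by
        simpa only [hzx] using hzφ
      have : y = x₀ := tendsto_nhds_unique h2 h1
      rw [this] at hyb
      exact absurd heq hyb.ne
  have := (convex_ball (0 : E) 1).isPreconnected.subset_of_closure_inter_subset hAopen hAne hAcl
  exact fun y hy => this hy

/-! #### The splice as a partial diffeomorphism of the open ball -/

/-- The splice is a bijection of the open unit ball. [folklore] -/
theorem bijOn_splice (h : IsInnerCollar ε θ θinv) (hs : SpliceHyp ε θ ε₃ c C₁ L) :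
    BijOn (splice θ L) (ball (0 : E) 1) (ball 0 1) :=
  ⟨hs.mapsTo_splice h, hs.injOn_splice, hs.surjOn_splice h⟩

omit [FiniteDimensional ℝ E] in
/-- The splice is continuous on the open unit ball. [folklore] -/
theorem continuousOn_splice (h : IsInnerCollar ε θ θinv) (hs : SpliceHyp ε θ ε₃ c C₁ L) :
    ContinuousOn (splice θ L) (ball (0 : E) 1) := fun _ hx =>
  (h.contDiffAt_splice hs.L_pos hs.exp_lt_ε (mem_ball_zero_iff.1 hx)).continuousAt.continuousWithinAt

/-- The splice restricted to the open unit ball, as an `OpenPartialHomeomorph` with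
`source = target = ball 0 1`. [folklore] -/
def spliceHomeomorph (h : IsInnerCollar ε θ θinv) (hs : SpliceHyp ε θ ε₃ c C₁ L) :
    OpenPartialHomeomorph E E :=
  haveI : Nonempty E := ⟨0⟩
  OpenPartialHomeomorph.ofContinuousOpenRestrict ((hs.bijOn_splice h).toPartialEquiv _ _ _)
    (hs.continuousOn_splice h) (by
      intro U hU
      rw [restrict_eq, image_comp]
      have hval : IsOpen (Subtype.val '' U) :=
        (isOpen_ball (x := (0 : E)) (ε := 1)).isOpenMap_subtype_val U hU
      exact hs.isOpen_image_splice h hval (Subtype.coe_image_subset _ U))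
    isOpen_ball

/-- The partial homeomorphism is the splice as a function (definitional). [folklore] -/
theorem spliceHomeomorph_coe (h : IsInnerCollar ε θ θinv) (hs : SpliceHyp ε θ ε₃ c C₁ L) :
    ⇑(hs.spliceHomeomorph h) = splice θ L := rfl

/-- Its source is the open unit ball (definitional). [folklore] -/
theorem spliceHomeomorph_source (h : IsInnerCollar ε θ θinv) (hs : SpliceHyp ε θ ε₃ c C₁ L) :
    (hs.spliceHomeomorph h).source = ball 0 1 := rfl

/-- Its target is the open unit ball (definitional). [folklore] -/
theorem spliceHomeomorph_target (h : IsInnerCollar ε θ θinv) (hs : SpliceHyp ε θ ε₃ c C₁ L) :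
    (hs.spliceHomeomorph h).target = ball 0 1 := rfl

/-- The splice is `C^∞` on the open unit ball. [folklore] -/
theorem contDiffOn_spliceHomeomorph (h : IsInnerCollar ε θ θinv) (hs : SpliceHyp ε θ ε₃ c C₁ L) :
    ContDiffOn ℝ ∞ (hs.spliceHomeomorph h) (ball 0 1) := fun _ hx =>
  (h.contDiffAt_splice hs.L_pos hs.exp_lt_ε (mem_ball_zero_iff.1 hx)).contDiffWithinAt

/-- The inverse of the splice is `C^∞` on the open ball (inverse function theorem:
`OpenPartialHomeomorph.contDiffAt_symm`). [folklore] -/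
theorem contDiffOn_spliceHomeomorph_symm (h : IsInnerCollar ε θ θinv)
    (hs : SpliceHyp ε θ ε₃ c C₁ L) :
    ContDiffOn ℝ ∞ (hs.spliceHomeomorph h).symm (ball 0 1) := by
  intro a ha
  have ha' : a ∈ (hs.spliceHomeomorph h).target := ha
  have hxa : (hs.spliceHomeomorph h).symm a ∈ ball (0 : E) 1 :=
    (hs.spliceHomeomorph h).map_target ha'
  obtain ⟨D, hD⟩ := hs.exists_hasStrictFDerivAt h (mem_ball_zero_iff.1 hxa)
  exact ((hs.spliceHomeomorph h).contDiffAt_symm ha' hD.hasFDerivAt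
    (h.contDiffAt_splice hs.L_pos hs.exp_lt_ε (mem_ball_zero_iff.1 hxa))).contDiffWithinAt

end SpliceHyp

/-! ### Main results -/

/-- **Uniqueness of collars of `∂𝔻` (ambient form; Hirsch's ambient collar theorem for the
ball).** An inner collar `θ` of the unit sphere agrees, on a thin open shell
`{1 - δ ≤ ‖x‖ < 1}`, with a `C^∞` diffeomorphism `Θ` of the open unit ball onto itself which is
the identity on the ball of radius `1 - ε`. (So the collar `θ` and the standard collar `id`
differ by a diffeomorphism of the open ball supported near the sphere.) Hirsch (1976), Ch. 8,
Thm. 1.8 and the remark following it ("a theorem analogous to Theorem 1.8 holds for collars on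
`∂M`"), here for `M = 𝔻` with an elementary proof: splice `θ` with `id` along a cutoff that
varies on a logarithmic scale in the distance to the sphere. [cite: HirschDT1976, Ch. 8 Thm. 1.8] -/
theorem exists_openPartialHomeomorph_extend (h : IsInnerCollar ε θ θinv) :
    ∃ (Θ : OpenPartialHomeomorph E E) (δ : ℝ), 0 < δ ∧ δ < ε ∧
      Θ.source = ball 0 1 ∧ Θ.target = ball 0 1 ∧
      ContDiffOn ℝ ∞ Θ (ball 0 1) ∧ ContDiffOn ℝ ∞ Θ.symm (ball 0 1) ∧
      (∀ x : E, 1 - δ ≤ ‖x‖ → ‖x‖ < 1 → Θ x = θ x) ∧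
      (∀ x : E, ‖x‖ ≤ 1 - ε → Θ x = x) := by
  obtain ⟨ε₃, c, C₁, L, hs⟩ := h.exists_spliceHyp
  refine ⟨hs.spliceHomeomorph h, exp (-2 * L), exp_pos _, ?_, rfl, rfl,
    hs.contDiffOn_spliceHomeomorph h, hs.contDiffOn_spliceHomeomorph_symm h, ?_, ?_⟩
  · have : exp (-2 * L) < exp (-L) := exp_lt_exp.2 (by linarith [hs.L_pos])
    exact this.trans hs.exp_lt_ε
  · intro x h1 h2
    exact splice_eq hs.L_pos h1 h2
  · intro x hx
    exact splice_eq_self hs.L_pos (hx.trans (by linarith [hs.exp_lt_ε]))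

/-- **Any two inner collars of the sphere differ by a diffeomorphism of the open ball**: there
is a `C^∞` diffeomorphism `G` of the open unit ball onto itself with `G (θ₁ x) = θ₂ x` on a thin
open shell `{1 - δ ≤ ‖x‖ < 1}`. This is the uniqueness of collars of `∂𝔻 = 𝕊` up to
diffeomorphism (Hirsch (1976), Ch. 8, Thm. 1.8 for collars; Munkres, *Elementary Differential
Topology* (1966), §6), in the ambient coordinates of `Literature.Topology.FourManifolds.IsInnerCollar`.
[cite: HirschDT1976, Ch. 8 Thm. 1.8] -/
theorem exists_openPartialHomeomorph_conj {θ₁ θinv₁ θ₂ θinv₂ : E → E}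
    (h₁ : IsInnerCollar ε θ₁ θinv₁) (h₂ : IsInnerCollar ε θ₂ θinv₂) :
    ∃ (G : OpenPartialHomeomorph E E) (δ : ℝ), 0 < δ ∧ δ < ε ∧
      G.source = ball 0 1 ∧ G.target = ball 0 1 ∧
      ContDiffOn ℝ ∞ G (ball 0 1) ∧ ContDiffOn ℝ ∞ G.symm (ball 0 1) ∧
      ∀ x : E, 1 - δ ≤ ‖x‖ → ‖x‖ < 1 → G (θ₁ x) = θ₂ x := by
  obtain ⟨Θ₁, δ₁, hδ₁, hδ₁ε, hs₁, ht₁, hc₁, hc₁', he₁, -⟩ := h₁.exists_openPartialHomeomorph_extend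
  obtain ⟨Θ₂, δ₂, hδ₂, hδ₂ε, hs₂, ht₂, hc₂, hc₂', he₂, -⟩ := h₂.exists_openPartialHomeomorph_extend
  have hsrc : (Θ₁.symm.trans Θ₂).source = ball 0 1 := by
    rw [OpenPartialHomeomorph.trans_source, OpenPartialHomeomorph.symm_source, ht₁, hs₂]
    refine inter_eq_left.2 fun y hy => ?_
    have := Θ₁.map_target (by rw [ht₁]; exact hy)
    rwa [hs₁] at this
  have htgt : (Θ₁.symm.trans Θ₂).target = ball 0 1 := by
    rw [OpenPartialHomeomorph.trans_target, ht₂, OpenPartialHomeomorph.symm_target, hs₁]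
    refine inter_eq_left.2 fun y hy => ?_
    have := Θ₂.map_target (by rw [ht₂]; exact hy)
    rwa [hs₂] at this
  refine ⟨Θ₁.symm.trans Θ₂, min δ₁ δ₂, lt_min hδ₁ hδ₂, (min_le_left _ _).trans_lt hδ₁ε, hsrc, htgt,
    ?_, ?_, ?_⟩
  · rw [OpenPartialHomeomorph.coe_trans]
    refine hc₂.comp hc₁' fun y hy => ?_
    have := Θ₁.map_target (by rw [ht₁]; exact hy)
    rwa [hs₁] at this
  · rw [OpenPartialHomeomorph.trans_symm_eq_symm_trans_symm, OpenPartialHomeomorph.coe_trans,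
      OpenPartialHomeomorph.symm_symm]
    refine hc₁.comp hc₂' fun y hy => ?_
    have := Θ₂.map_target (by rw [ht₂]; exact hy)
    rwa [hs₂] at this
  · intro x hx1 hx2
    have hxs : x ∈ Θ₁.source := by rw [hs₁]; exact mem_ball_zero_iff.2 hx2
    rw [OpenPartialHomeomorph.coe_trans, comp_apply,
      ← he₁ x ((sub_le_sub_left (min_le_left _ _) _).trans hx1) hx2, Θ₁.left_inv hxs,
      he₂ x ((sub_le_sub_left (min_le_right _ _) _).trans hx1) hx2]

end IsInnerCollar

end InnerCollar

end Literature.Topology.FourManifolds
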